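import Summits.CriticalPhenomena.Ising3DConformalLimit.Theses.PrecisionLaplacian
import Literature.Probability.LatticeModels.CriticalTwoPointLawDimension
import Literature.Barriers.CriticalPhenomena.TwoPointLawNotMoebius
-- LANDED negative-side files of this seat (cycle 2); provers / ideators / planners may import them directly:
import Summits.CriticalPhenomena.Ising3DConformalLimit.Theorems.MoebiusLimitOfTwoPointLaw.Negative.ReadBack
import Summits.CriticalPhenomena.Ising3DConformalLimit.Theorems.MoebiusLimitOfTwoPointLaw.Negative.CanonicalForm
import Summits.CriticalPhenomena.Ising3DConformalLimit.Theorems.MoebiusLimitOfTwoPointLaw.Negative.GroupLemmaNeedsTranslation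
import Summits.CriticalPhenomena.Ising3DConformalLimit.Theorems.MoebiusLimitOfTwoPointLaw.Negative.ReversalPrinciple
import Summits.CriticalPhenomena.Ising3DConformalLimit.Theorems.MoebiusLimitOfTwoPointLaw.Negative.TwoPointConvergence
import Summits.CriticalPhenomena.Ising3DConformalLimit.Theorems.MoebiusLimitOfTwoPointLaw.Negative.EvenReduction
import Summits.CriticalPhenomena.Ising3DConformalLimit.Theorems.MoebiusLimitOfTwoPointLaw.Negative.EvenReductionSharp
import Summits.CriticalPhenomena.Ising3DConformalLimit.Theorems.MoebiusLimitOfTwoPointLaw.Negative.TranslationFree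

/-!
# Disproof of `MoebiusLimitOfTwoPointLaw` (crux stmt-CriticalPhenomena-4801) — standing adversary file

Route decl: `Summit.CriticalPhenomena.Ising3DConformalLimit.Theses.PrecisionLaplacian.MoebiusLimitOfTwoPointLaw`
(shared verbatim with `Theses.BernsteinTemperature`). Shape: `P → Q` with
* `P` = item 0634 (isotropic pure power law `⟨σ₀σ_x⟩_{β_c} ‖x‖₂^{2Δ} → c > 0`, cofinitely on `ℤ³`),
* `Q` = item 1344 (a non-degenerate Möbius-covariant pointwise scaling limit `(ρ, Δ, S)` of `criticalCorr 3`).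

## Findings (index; cycle 1 = seat `refuter-cdisprove-…-4801-0`, cycle 2 = this seat `…-g2-0`)

VERDICT SO FAR: **no kill; the crux resists structurally**: `¬crux ↔ P ∧ ¬Q` (§1), i.e. a refutation needs a
PROOF of item 0634 (open) AND a refutation of the summit conjunct minus clause (iii). Neither tree junk nor a
cheap argument delivers either half (§1: `P` is consistent with and pinned by the tree bounds; `Q` has no
coincident-locus / `n = 0,1,2` / inversion-at-`0` junk because `S` is existential and `S := 0` off
`NonCoincident` is admissible).

Cycle-1 results LANDED in the tree (read them there; this file only re-exports them in crux vocabulary):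
* `Literature/Probability/LatticeModels/CriticalTwoPointLawDimension.lean` (p68682): under `P` with exponent `Δ`,
  every non-degenerate scale-covariant pointwise limit has `Δ' = Δ ∈ [1/2,1]` and `ρ(δ_k)² δ_k^{2Δ} → S₂(0,e)/c`
  (`scalingDimension_eq_of_twoPointLaw`, `rho_sq_asymptotics_of_twoPointLaw`, `twoPointLaw_exponent_mem_Icc`,
  `criticalTwoPoint_tendsto_zero_cofinite`).
* `Literature/Barriers/CriticalPhenomena/TwoPointLawNotMoebius.lean` (p69070): the MODEL-BLIND strengthening
  (`criticalCorr 3` replaced by an arbitrary lattice family) is FALSE (`not_twoPointLawMoebiusUpgrade`): a lattice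
  family with the EXACT two-point law and no Möbius limit under any renormalisation; uniqueness of pointwise
  scaling limits up to a scalar (`tendsto_rescaledCorrelator_unique_upToScalar`).
Cycle-1 results NOT landed (evidence file `run/gate/evidence/stmt-CriticalPhenomena-4801/20260815T225910Z-Disproof.lean`,
1186 lines, rc 0, not readable from this seat's box): load-bearing `0 < c` (§1 below re-proves it), isotropy
load-bearing (sup-norm witness, n = 2 already fails), model-blind upgrade false even with Euclid + scale + U₄ ≢ 0 +
GKS/Lebowitz shapes (the lattice restriction of `ScaleNotMoebius.narrowFamily`).

Cycle-2 additions (this file):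
* §1  anatomy re-derived and kernel-checked: `crux_iff`, `not_crux_iff`, `crux_of_moebiusLimit`,
      `twoPointLawWithoutPosC_holds` / `cruxWithoutPosC_iff` (dropping `0 < c` collapses the crux to item 1344),
      `dimension_forced`, `exponent_window` (re-exports of p68682).
* §1b/§1c  **CANONICAL FORM** (new): `crux_iff_canonical` — the crux is EQUIVALENT to "for every `(Δ,c)`
      witnessing `P`, the `δ^{-nΔ}`-renormalised critical correlators converge locally uniformly off the
      diagonals to a non-degenerate Möbius family of dimension `Δ`" (`CanonicalMoebiusLimit Δ`); the `∃ρ ∃Δ'`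
      of item 1344 carry no freedom under item 0634. Tools: `tendsto_rho_sq_mul_rpow` (ρ²δ^{2Δ} → S₂(0,e₁)/c
      along the FULL filter), `hasPointwiseScalingLimit_of_ratio_tendsto` (model-blind stability of pointwise
      limits under renormalisations with convergent ratio — via local boundedness of lattice scaling limits,
      `exists_local_bound_of_hasPointwiseScalingLimit`), `twoPointLaw_exponent_unique`.
* §1d/§1e  LANDED `Negative/TwoPointConvergence.lean` (p71066) + `Negative/EvenReduction.lean` (p71588), re-exported
      below as `crux_arity_two`, `crux_iff_even`: under `P` with `ρ = δ^{-Δ}` the arities `0` (→ 1), odd (→ 0) and `2`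
      (→ `c‖x₀−x₁‖^{-2Δ}`, locally uniformly) are SETTLED, and **crux ⇔ ∀ (Δ,c) ⊨ P, ∃ Möbius-covariant `T` of
      dimension `Δ` whose EVEN arities `n ≥ 4` are the locally uniform limits of `δ^{-nΔ}⟨σ_{[x₁/δ]}⋯σ_{[xₙ/δ]}⟩_{β_c}`**;
      sharper (`Negative/EvenReductionSharp.lean` p71830 and `Negative/TranslationFree.lean` p72519, re-exported as
      `crux_iff_even_sharp` / `crux_iff_even_sharper`): SCALE COVARIANCE (exact mesh identity `[cx/δ] = [x/(δ/c)]`)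
      AND TRANSLATION INVARIANCE (axis-commensurate meshes `|a|/(m+1)`; no continuity of `T_n` needed) ARE FREE, so
      the prover's obligations are, for even `n ≥ 4`: locally uniform limits + `O(3)` + unit-inversion covariance.
* §2  model-blind strengthening refuted: `not_modelBlindCrux` (re-export of p69070 in crux vocabulary); §2b (COMPUTED,
      `RPDescendantWitness.md` in this crux directory + evidence `WITNESS.md`, kit j007583): reflection positivity is NOT an
      evasion by itself — the Schwinger functions of `s = Δ:φ²:` (generalized free field, weight 4) and of
      `s = Δ:φ₀²: = 2:|∇φ₀|²:` (massless free = Markov field, weight 3) are RP, Euclidean, scale covariant with exact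
      pure-power `S₂`, yet `S₄` is not inversion covariant (4-cycle Wick class: ratio 1.148 / 1.138 resp. 0.807 / 6.35 at two
      generic configurations, control class 1.000000); such scalar-descendant witnesses need weight `≥ 5/2 > 1`, so ANY
      RP-based proof of the crux must use the window `Δ ≤ 1` that `P` provides.
* §3  LINES UNDER ATTACK (crux-ideate round 1, `Cruxes/MoebiusLimitOfTwoPointLaw/Sketch*.lean`):
      card `two-shell-exchange-markov` — kinematic stubs A1–A3 PROVED (`kinematicNecessity`,
      `sphereInversionGivesExchange`, `baseCaseFromTwoPointLaw`), and the group lemma P2 shown to NEED translation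
      invariance: `not_groupLemmaWithoutTranslation` (an origin-sphere-inversion-covariant, continuous, normalised
      family that is not rotation invariant); §3c arity analysis of the exchange hierarchy (paper): `E_{2,2}`
      about all centres SUFFICES for inversion covariance of `S_4` given Euclid + scale + continuity (rank count
      of the admissible moves at the circumcentre against the special conformal generators), `n = 5` discrete,
      `n ≥ 6` vacuous at generic configurations. Card `multipole-ward-nonsat-endpoint` — glue B1 PROVED
      (`strictEtaFromNonSat`). Card `annulus-kelvin-symmetry-scale-axis-gibbs` — its global engine, the finite reversal
      principle `reversible_of_unique_symmetric_spec` (Sketch.lean), is PROVED (`Negative/ReversalPrinciple.lean`, p71253;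
      involutivity of `θ` not even needed). LANDED: `Theorems/MoebiusLimitOfTwoPointLaw/Negative/ReadBack.lean` (p70472),
      `…/CanonicalForm.lean` (p70473), `…/GroupLemmaNeedsTranslation.lean` (p70532), `…/ReversalPrinciple.lean` (p71253),
      `…/TwoPointConvergence.lean` (p71066), `…/EvenReduction.lean` (p71588), `…/EvenReductionSharp.lean` (p71830),
      `…/TranslationFree.lean` (p72519); and `Literature/Barriers/CriticalPhenomena/TwoPointLawNotMoebius.lean` docblock
      sharpening (p71510).
* §4  NUMERICS (kit jobs, ids in the docstrings): the rounding-free lattice instance of E_{2,2} at β_c(3).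
* §5  why it resists / what a prover must supply.
-/

noncomputable section

namespace Summit.CriticalPhenomena.Ising3DConformalLimit.Cruxes.MoebiusLimitOfTwoPointLaw.Disproof

open Literature.Probability.LatticeModels Filter Topology
open Summit.CriticalPhenomena.Ising3DConformalLimit.Theses.PrecisionLaplacian (MoebiusLimitOfTwoPointLaw)

/-- Points of `ℝ³`. -/
abbrev E3 : Type := EuclideanSpace ℝ (Fin 3)

/-! ## §1 Anatomy -/

/-- `P`, the hypothesis of the crux, verbatim: item 0634 `IsingEuclidUpgradeR2RotInvPowerLaw`. -/
def TwoPointLaw : Prop :=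
  ∃ Δ c : ℝ, 0 < c ∧ Tendsto (fun x : Site 3 =>
    criticalTwoPoint 3 x * Real.sqrt (∑ i, ((x i : ℝ)) ^ 2) ^ (2 * Δ)) cofinite (nhds c)

/-- `Q`, the conclusion of the crux, verbatim: item 1344 `PerfectScreening.MoebiusLimitExists`
(= the conjunct `CritIsing3DConformalLimit` minus clause (iii) `HasNontrivialU4`). -/
def MoebiusLimit : Prop :=
  ∃ (ρ : ℝ → ℝ) (Δ : ℝ) (S : CorrFamily 3), (∀ δ ∈ Set.Ioc (0:ℝ) 1, 0 < ρ δ) ∧ 0 < Δ ∧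
    HasPointwiseScalingLimit (criticalCorr 3) ρ S ∧ IsNondegenerateTwoPoint S ∧ IsMoebiusCovariant Δ S

/-- The crux IS `P → Q`, definitionally. -/
theorem crux_iff : MoebiusLimitOfTwoPointLaw ↔ (TwoPointLaw → MoebiusLimit) := Iff.rfl

/-- Any proof of item 1344 closes the crux (`fun _ => h`). -/
theorem crux_of_moebiusLimit (h : MoebiusLimit) : MoebiusLimitOfTwoPointLaw := fun _ => h

/-- Any refutation of item 0634 closes the crux vacuously. -/
theorem crux_of_not_twoPointLaw (h : ¬ TwoPointLaw) : MoebiusLimitOfTwoPointLaw := fun hP => absurd hP h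

/-- The summit conjunct implies `Q`, hence the crux. -/
theorem crux_of_conjunct (h : CritIsing3DConformalLimit) : MoebiusLimitOfTwoPointLaw := by
  obtain ⟨ρ, Δ, S, hρ, hΔ, hlim, hnd, hM, -⟩ := h
  exact fun _ => ⟨ρ, Δ, S, hρ, hΔ, hlim, hnd, hM⟩

/-- **What a kill costs.** `¬ crux ↔ P ∧ ¬Q`: a refutation must PROVE the two-point law (item 0634, open)
and REFUTE item 1344, hence the conjunct `Ising3DConformalLimit` itself (`crux_of_conjunct`). -/
theorem not_crux_iff : ¬ MoebiusLimitOfTwoPointLaw ↔ (TwoPointLaw ∧ ¬ MoebiusLimit) := by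
  rw [crux_iff]; push Not; rfl

/-- A kill refutes the summit conjunct. -/
theorem not_conjunct_of_not_crux (h : ¬ MoebiusLimitOfTwoPointLaw) : ¬ CritIsing3DConformalLimit :=
  fun hc => h (crux_of_conjunct hc)

/-! ### `0 < c` is load-bearing -/

/-- `P` with the side condition `0 < c` dropped. -/
def TwoPointLawWithoutPosC : Prop :=
  ∃ Δ c : ℝ, Tendsto (fun x : Site 3 =>
    criticalTwoPoint 3 x * Real.sqrt (∑ i, ((x i : ℝ)) ^ 2) ^ (2 * Δ)) cofinite (nhds c)

/-- Without `0 < c` the hypothesis is a THEOREM of the tree (`Δ = 0`, `c = 0`: `⟨σ₀σ_x⟩_{β_c} → 0`,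
`criticalTwoPoint_tendsto_zero_cofinite`, from `criticalTwoPoint_bounds_holds`). -/
theorem twoPointLawWithoutPosC_holds : TwoPointLawWithoutPosC := by
  refine ⟨0, 0, ?_⟩
  have h := criticalTwoPoint_tendsto_zero_cofinite
  refine h.congr fun x => ?_
  simp

/-- The crux with `0 < c` dropped from its hypothesis. -/
def CruxWithoutPosC : Prop := TwoPointLawWithoutPosC → MoebiusLimit

/-- … is EQUIVALENT to item 1344 itself: dropping `0 < c` deletes the hypothesis. Any proof of the crux
that does not use `0 < c` is a proof of 1344 outright. -/
theorem cruxWithoutPosC_iff : CruxWithoutPosC ↔ MoebiusLimit :=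
  ⟨fun h => h twoPointLawWithoutPosC_holds, fun h _ => h⟩

/-! ### What `P` pins (re-exports of p68682 in crux vocabulary) -/

/-- Under `P` with exponent `Δ`, every witness `(ρ, Δ', S)` of `Q` has `Δ' = Δ` and `Δ ∈ [1/2, 1]`. -/
theorem dimension_forced {Δ c : ℝ} (hc : 0 < c)
    (hP : Tendsto (fun x : Site 3 =>
      criticalTwoPoint 3 x * Real.sqrt (∑ i, ((x i : ℝ)) ^ 2) ^ (2 * Δ)) cofinite (nhds c))
    {ρ : ℝ → ℝ} {Δ' : ℝ} {S : CorrFamily 3} (hρ : ∀ δ ∈ Set.Ioc (0 : ℝ) 1, 0 < ρ δ)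
    (hlim : HasPointwiseScalingLimit (criticalCorr 3) ρ S) (hnd : IsNondegenerateTwoPoint S)
    (hM : IsMoebiusCovariant Δ' S) : Δ' = Δ ∧ Δ ∈ Set.Icc (1 / 2 : ℝ) 1 :=
  moebius_scalingDimension_eq_of_twoPointLaw hc hP hρ hlim hnd hM

/-- Under `P`, the exponent lies in `[1/2, 1]` (tree bounds `c‖x‖⁻² ≤ G ≤ C‖x‖⁻¹`). -/
theorem exponent_window {Δ c : ℝ} (hc : 0 < c)
    (hP : Tendsto (fun x : Site 3 =>
      criticalTwoPoint 3 x * Real.sqrt (∑ i, ((x i : ℝ)) ^ 2) ^ (2 * Δ)) cofinite (nhds c)) :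
    Δ ∈ Set.Icc (1 / 2 : ℝ) 1 :=
  twoPointLaw_exponent_mem_Icc hc hP

/-- Under `P`, the renormalisation of ANY pointwise limit is forced along dyadic meshes:
`ρ(2^{-(k+1)})² (2^{k+1})^{-2Δ} → S₂(0,e₁)/c`. -/
theorem renormalisation_forced {Δ c : ℝ} (hc : 0 < c)
    (hP : Tendsto (fun x : Site 3 =>
      criticalTwoPoint 3 x * Real.sqrt (∑ i, ((x i : ℝ)) ^ 2) ^ (2 * Δ)) cofinite (nhds c))
    {ρ : ℝ → ℝ} {S : CorrFamily 3} (hlim : HasPointwiseScalingLimit (criticalCorr 3) ρ S) :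
    Tendsto (fun k : ℕ => ρ ((2 : ℝ)⁻¹ ^ (k + 1)) ^ 2 * (((2 : ℝ) ^ (k + 1)) ^ (2 * Δ))⁻¹) atTop
      (nhds (S 2 ![0, EuclideanSpace.single (0 : Fin 3) ((1 : ℕ) : ℝ)] / c)) :=
  rho_sq_asymptotics_of_twoPointLaw hc hP hlim

/-! ## §2 The model-blind strengthening is false (re-export of p69070) -/

/-- The crux with `criticalCorr 3` replaced by an ARBITRARY lattice family `G` (its two-point function read
at `![0, x]`): "isotropic two-point power law ⇒ non-degenerate Möbius pointwise limit". -/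
def ModelBlindCrux : Prop := ∀ G : LatticeCorrFamily 3, Literature.Barriers.CriticalPhenomena.TwoPointLawMoebiusUpgradeFor G

/-- FALSE: `Literature.Barriers.CriticalPhenomena.not_twoPointLawMoebiusUpgrade` (the lattice sampling of
`ScaleNotMoebius.narrowFamily 1` has the exact law and no Möbius limit under any `ρ`, any `Δ'`). Hence ANY
proof of the crux must use properties of `criticalCorr 3` beyond its two-point function (reflection
positivity of the full family, DLR/Markov structure, random currents, …). -/
theorem not_modelBlindCrux : ¬ ModelBlindCrux :=
  Literature.Barriers.CriticalPhenomena.not_twoPointLawMoebiusUpgrade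

/-- … while the crux is exactly the `G := criticalCorr 3` instance of the model-blind statement. -/
theorem crux_iff_modelBlind_instance :
    MoebiusLimitOfTwoPointLaw ↔
      ((∃ Δ c : ℝ, 0 < c ∧ Tendsto (fun x : Site 3 =>
          (criticalCorr 3) 2 ![0, x] * Real.sqrt (∑ i, ((x i : ℝ)) ^ 2) ^ (2 * Δ)) cofinite (nhds c)) →
        MoebiusLimit) := by
  rw [crux_iff, TwoPointLaw]
  simp only [criticalCorr_two]
/-! ### §1b Canonical form of the crux: `ρ := δ^{-Δ}` with the SAME `Δ` as in `P`

Under `P` with exponent `Δ` the existential renormalisation and dimension in `Q` carry no freedom: the crux is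
EQUIVALENT to "for every `(Δ, c)` witnessing the two-point law, the canonically renormalised correlators
`δ^{-nΔ} ⟨σ_{[x₁/δ]} ⋯ σ_{[xₙ/δ]}⟩_{β_c}` converge (locally uniformly off the diagonals) to a non-degenerate
Möbius-covariant family of dimension `Δ`" (`crux_iff_canonical`). Ingredients: `Δ' = Δ` (p68682);
`ρ(δ)² δ^{2Δ} → S₂(0,e₁)/c` along the FULL filter `δ → 0⁺` (`tendsto_rho_sq_mul_rpow`, new: cycle 1 had the dyadic
subsequence); and the model-blind fact that `HasPointwiseScalingLimit` is stable under renormalisations with a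
convergent ratio (`hasPointwiseScalingLimit_of_ratio_tendsto`) — which needs, and gets for free for LATTICE
families, local boundedness of the limit (a rescaled lattice correlator takes finitely many values near any
configuration). -/

section Canonical

variable {G : LatticeCorrFamily 3} {ρ ρ' : ℝ → ℝ} {S : CorrFamily 3}

/-- Coordinates are bounded by the Euclidean norm. -/
theorem abs_coord_le_norm (v : E3) (j : Fin 3) : |v j| ≤ ‖v‖ := by
  have h := PiLp.norm_apply_le v j
  rwa [Real.norm_eq_abs] at h

/-- A rescaled LATTICE correlator at a fixed mesh `δ > 0` is bounded on every ball of configurations: the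
roundings `[y/δ]` range over a finite set. -/
theorem rescaledCorrelator_bounded_on_ball (G : LatticeCorrFamily 3) (ρ : ℝ → ℝ) (n : ℕ) {δ : ℝ}
    (hδ : 0 < δ) (x : Fin n → E3) (r : ℝ) :
    ∃ B : ℝ, ∀ y ∈ Metric.ball x r, |rescaledCorrelator G ρ n δ y| ≤ B := by
  -- the finite box of possible roundings
  set K : Set (Fin n → Site 3) :=
    Set.pi Set.univ fun i => Set.pi Set.univ fun j =>
      Set.Icc ⌊((x i) j - r) / δ⌋ ⌈((x i) j + r) / δ⌉ with hK
  have hKfin : K.Finite :=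
    Set.Finite.pi fun i => Set.Finite.pi fun j => Set.finite_Icc _ _
  have hmem : ∀ y ∈ Metric.ball x r, (fun i => latticeApprox δ (y i)) ∈ K := by
    intro y hy
    simp only [hK, Set.mem_pi, Set.mem_univ, true_implies, Set.mem_Icc, latticeApprox_apply]
    intro i j
    have hyi : dist (y i) (x i) < r := lt_of_le_of_lt (dist_le_pi_dist y x i) hy
    rw [dist_eq_norm] at hyi
    have hc : |(y i) j - (x i) j| < r := by
      have h1 := abs_coord_le_norm (y i - x i) j
      have h2 : (y i - x i) j = (y i) j - (x i) j := rfl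
      rw [h2] at h1
      linarith
    rw [abs_lt] at hc
    constructor
    · exact Int.floor_mono ((div_le_div_iff_of_pos_right hδ).2 (by linarith))
    · exact (Int.floor_mono ((div_le_div_iff_of_pos_right hδ).2 (by linarith))).trans
        (Int.floor_le_ceil _)
  -- values on the ball lie in a finite set of reals
  have hvals : ∀ y ∈ Metric.ball x r,
      rescaledCorrelator G ρ n δ y ∈ (fun k => ρ δ ^ n * G n k) '' K := by
    intro y hy
    exact ⟨_, hmem y hy, rfl⟩
  obtain ⟨B, hB⟩ := ((hKfin.image fun k => ρ δ ^ n * G n k).image fun v => |v|).bddAbove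
  refine ⟨B, fun y hy => hB ⟨_, hvals y hy, rfl⟩⟩

/-- **Pointwise scaling limits of lattice families are locally bounded** off the coincident locus. -/
theorem exists_local_bound_of_hasPointwiseScalingLimit (hlim : HasPointwiseScalingLimit G ρ S) (n : ℕ)
    {x : Fin n → E3} (hx : x ∈ NonCoincident 3 n) :
    ∃ t ∈ 𝓝[NonCoincident 3 n] x, ∃ B : ℝ, 0 < B ∧ ∀ y ∈ t, |S n y| ≤ B := by
  obtain ⟨t₁, ht₁, hev⟩ := Metric.tendstoLocallyUniformlyOn_iff.1 (hlim n) 1 one_pos x hx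
  have hpos : ∀ᶠ δ : ℝ in 𝓝[>] 0, 0 < δ := eventually_mem_nhdsWithin
  obtain ⟨δ₀, hclose, hδ₀⟩ := (hev.and hpos).exists
  obtain ⟨B₀, hB₀⟩ := rescaledCorrelator_bounded_on_ball G ρ n hδ₀ x 1
  refine ⟨t₁ ∩ Metric.ball x 1, inter_mem ht₁ (mem_nhdsWithin_of_mem_nhds (Metric.ball_mem_nhds x one_pos)),
    |B₀| + 1, by positivity, fun y hy => ?_⟩
  have h1 := hclose y hy.1
  have h2 := hB₀ y hy.2
  rw [Real.dist_eq] at h1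
  have h3 : |S n y| ≤ |S n y - rescaledCorrelator G ρ n δ₀ y| + |rescaledCorrelator G ρ n δ₀ y| := by
    have := abs_add_le (S n y - rescaledCorrelator G ρ n δ₀ y) (rescaledCorrelator G ρ n δ₀ y)
    rwa [sub_add_cancel] at this
  linarith [le_abs_self B₀]

/-- Changing the renormalisation: `ρ'^n G = (ρ'/ρ)^n · (ρ^n G)`. -/
theorem rescaledCorrelator_change (G : LatticeCorrFamily 3) {ρ ρ' : ℝ → ℝ} (n : ℕ) {δ : ℝ}
    (hρ : ρ δ ≠ 0) (y : Fin n → E3) :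
    rescaledCorrelator G ρ' n δ y = (ρ' δ / ρ δ) ^ n * rescaledCorrelator G ρ n δ y := by
  rw [rescaledCorrelator_apply, rescaledCorrelator_apply, ← mul_assoc, div_pow,
    div_mul_cancel₀ _ (pow_ne_zero n hρ)]

/-- **Stability of pointwise scaling limits under renormalisations with a convergent ratio** (model-blind,
every lattice family): if `ρ^n G_n([·/δ]) → S_n` locally uniformly off the diagonals and `ρ'/ρ → μ`, then
`ρ'^n G_n([·/δ]) → μ^n S_n` locally uniformly off the diagonals. -/
theorem hasPointwiseScalingLimit_of_ratio_tendsto {μ : ℝ} (hlim : HasPointwiseScalingLimit G ρ S)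
    (hρ : ∀ δ ∈ Set.Ioc (0 : ℝ) 1, ρ δ ≠ 0)
    (hq : Tendsto (fun δ => ρ' δ / ρ δ) (𝓝[>] 0) (𝓝 μ)) :
    HasPointwiseScalingLimit G ρ' (fun n x => μ ^ n * S n x) := by
  intro n
  rw [Metric.tendstoLocallyUniformlyOn_iff]
  intro ε hε x hx
  obtain ⟨t₀, ht₀, B, hB, hbound⟩ := exists_local_bound_of_hasPointwiseScalingLimit hlim n hx
  set M : ℝ := |μ ^ n| + 1 with hM
  have hMpos : 0 < M := by positivity
  obtain ⟨t₁, ht₁, hev₁⟩ :=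
    Metric.tendstoLocallyUniformlyOn_iff.1 (hlim n) (ε / (2 * M)) (by positivity) x hx
  have hqn : Tendsto (fun δ => (ρ' δ / ρ δ) ^ n) (𝓝[>] 0) (𝓝 (μ ^ n)) := hq.pow n
  have hev₂ : ∀ᶠ δ in 𝓝[>] (0 : ℝ), |(ρ' δ / ρ δ) ^ n - μ ^ n| < ε / (2 * B) := by
    have h := Metric.tendsto_nhds.1 hqn (ε / (2 * B)) (by positivity)
    simpa [Real.dist_eq] using h
  have hev₃ : ∀ᶠ δ in 𝓝[>] (0 : ℝ), |(ρ' δ / ρ δ) ^ n - μ ^ n| < 1 := by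
    have h := Metric.tendsto_nhds.1 hqn 1 one_pos
    simpa [Real.dist_eq] using h
  have hIoc : ∀ᶠ δ : ℝ in 𝓝[>] 0, δ ∈ Set.Ioc (0 : ℝ) 1 := Ioc_mem_nhdsGT one_pos
  refine ⟨t₀ ∩ t₁, inter_mem ht₀ ht₁, ?_⟩
  filter_upwards [hev₁, hev₂, hev₃, hIoc] with δ h₁ h₂ h₃ hδ y hy
  set q : ℝ := (ρ' δ / ρ δ) ^ n with hqdef
  set F : ℝ := rescaledCorrelator G ρ n δ y with hF
  set f : ℝ := S n y with hf
  have hq1 : |q| ≤ M := by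
    have := abs_sub_abs_le_abs_sub q (μ ^ n)
    rw [hM]; linarith
  have hFf : |f - F| < ε / (2 * M) := by
    have := h₁ y hy.2; rwa [Real.dist_eq] at this
  have hfB : |f| ≤ B := hbound y hy.1
  rw [rescaledCorrelator_change G n (hρ δ hδ) y, Real.dist_eq]
  show |μ ^ n * f - q * F| < ε
  have key : μ ^ n * f - q * F = q * (f - F) - (q - μ ^ n) * f := by ring
  rw [key]
  calc |q * (f - F) - (q - μ ^ n) * f|
      ≤ |q * (f - F)| + |(q - μ ^ n) * f| := abs_sub _ _
    _ = |q| * |f - F| + |q - μ ^ n| * |f| := by rw [abs_mul, abs_mul]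
    _ ≤ M * |f - F| + |q - μ ^ n| * B := by
        gcongr
    _ < M * (ε / (2 * M)) + (ε / (2 * B)) * B := by
        gcongr
    _ = ε := by field_simp; ring

/-- Scalar multiples `κ^n S_n` of a Möbius-covariant family are Möbius covariant (same `Δ`). -/
theorem isMoebiusCovariant_const_pow_mul {Δ κ : ℝ} {S : CorrFamily 3} (h : IsMoebiusCovariant Δ S) :
    IsMoebiusCovariant Δ (fun n x => κ ^ n * S n x) := by
  obtain ⟨⟨ht, hr⟩, hs, hi⟩ := h
  refine ⟨⟨fun n v x => ?_, fun n R x => ?_⟩, fun n c hc x => ?_, fun n x hx => ?_⟩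
  · simp only [ht n v x]
  · simp only [hr n R x]
  · simp only [hs n c hc x]; ring
  · simp only [hi n x hx]; ring

/-- `[e₁/δ] = ⌊1/δ⌋ e₁` at every mesh. -/
theorem latticeApprox_unitVec (δ : ℝ) :
    latticeApprox δ (EuclideanSpace.single (0 : Fin 3) (1 : ℝ)) = Pi.single (0 : Fin 3) ⌊1 / δ⌋ := by
  funext i
  rw [latticeApprox_apply, unitVec_apply]
  by_cases hi : i = 0
  · subst hi; rw [if_pos rfl, Pi.single_eq_same]
  · rw [if_neg hi, Pi.single_eq_of_ne hi, zero_div, Int.floor_zero]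

/-- The rescaled critical two-point correlator at `(0, e₁)`, every mesh: `ρ(δ)² ⟨σ₀σ_{⌊1/δ⌋e₁}⟩_{β_c}`. -/
theorem rescaledCorrelator_criticalCorr_unitVec (ρ : ℝ → ℝ) (δ : ℝ) :
    rescaledCorrelator (criticalCorr 3) ρ 2 δ ![0, EuclideanSpace.single (0 : Fin 3) (1 : ℝ)] =
      ρ δ ^ 2 * criticalTwoPoint 3 (Pi.single (0 : Fin 3) ⌊1 / δ⌋) := by
  rw [rescaledCorrelator_apply, ← criticalCorr_two]
  congr 1
  congr 1
  funext i
  fin_cases i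
  · simp [latticeApprox_zero]
  · simpa using latticeApprox_unitVec δ

/-- `⌊1/δ⌋ → +∞` as `δ → 0⁺`. -/
theorem tendsto_floor_one_div : Tendsto (fun δ : ℝ => ⌊1 / δ⌋) (𝓝[>] (0 : ℝ)) atTop := by
  have h1 : Tendsto (fun δ : ℝ => 1 / δ) (𝓝[>] 0) atTop := by
    simpa only [one_div] using tendsto_inv_nhdsGT_zero (𝕜 := ℝ)
  exact tendsto_floor_atTop.comp h1

/-- The two-point law read along `⌊1/δ⌋ e₁`: `G(⌊1/δ⌋e₁) ⌊1/δ⌋^{2Δ} → c` as `δ → 0⁺`. -/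
theorem twoPointLaw_along_mesh {Δ c : ℝ}
    (hP : Tendsto (fun x : Site 3 =>
      criticalTwoPoint 3 x * Real.sqrt (∑ i, ((x i : ℝ)) ^ 2) ^ (2 * Δ)) cofinite (nhds c)) :
    Tendsto (fun δ : ℝ => criticalTwoPoint 3 (Pi.single (0 : Fin 3) ⌊1 / δ⌋) * ((⌊1 / δ⌋ : ℤ) : ℝ) ^ (2 * Δ))
      (𝓝[>] (0 : ℝ)) (nhds c) := by
  have hinj : Function.Injective fun m : ℤ => (Pi.single (0 : Fin 3) m : Site 3) := fun a b h => by
    simpa using congrFun h 0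
  have h := hP.comp (hinj.tendsto_cofinite.comp (tendsto_floor_one_div.mono_right atTop_le_cofinite))
  have hIoc : ∀ᶠ δ : ℝ in 𝓝[>] 0, δ ∈ Set.Ioc (0 : ℝ) 1 := Ioc_mem_nhdsGT one_pos
  refine h.congr' ?_
  filter_upwards [hIoc] with δ hδ
  simp only [Function.comp_apply]
  rw [sqrt_sum_sq_single_axis, abs_of_pos]
  have h1 : (1 : ℤ) ≤ ⌊1 / δ⌋ := Int.le_floor.2 (by rw [Int.cast_one]; exact (one_le_div hδ.1).2 hδ.2)
  exact_mod_cast h1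

/-- **The renormalisation along the full filter.** Under the two-point law `(Δ, c)`, every pointwise scaling
limit `(ρ, S)` of `criticalCorr 3` has `ρ(δ)² δ^{2Δ} → S₂(0,e₁)/c` as `δ → 0⁺` (cycle 1 / p68682 had the
dyadic subsequence `δ_k = 2^{-(k+1)}`; here the whole filter, via `δ⌊1/δ⌋ → 1`). -/
theorem tendsto_rho_sq_mul_rpow {Δ c : ℝ} (hc : 0 < c)
    (hP : Tendsto (fun x : Site 3 =>
      criticalTwoPoint 3 x * Real.sqrt (∑ i, ((x i : ℝ)) ^ 2) ^ (2 * Δ)) cofinite (nhds c))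
    {ρ : ℝ → ℝ} {S : CorrFamily 3} (hlim : HasPointwiseScalingLimit (criticalCorr 3) ρ S) :
    Tendsto (fun δ : ℝ => ρ δ ^ 2 * δ ^ (2 * Δ)) (𝓝[>] (0 : ℝ))
      (nhds (S 2 ![0, EuclideanSpace.single (0 : Fin 3) (1 : ℝ)] / c)) := by
  set s₁ := S 2 ![0, EuclideanSpace.single (0 : Fin 3) (1 : ℝ)] with hs₁
  -- (A) ρ² G(m e₁) → s₁, m = ⌊1/δ⌋
  have hA : Tendsto (fun δ => ρ δ ^ 2 * criticalTwoPoint 3 (Pi.single (0 : Fin 3) ⌊1 / δ⌋)) (𝓝[>] 0)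
      (nhds s₁) := by
    have h := (hlim 2).tendsto_at (zero_unitVec_mem_nonCoincident (t := (1 : ℝ)) one_ne_zero)
    refine h.congr fun δ => ?_
    exact rescaledCorrelator_criticalCorr_unitVec ρ δ
  -- (B) G(m e₁) m^{2Δ} → c
  have hB := twoPointLaw_along_mesh hP
  -- (C) (δ m)^{2Δ} → 1
  have hC : Tendsto (fun δ : ℝ => (δ * ((⌊1 / δ⌋ : ℤ) : ℝ)) ^ (2 * Δ)) (𝓝[>] 0) (nhds 1) := by
    have h := (Literature.Barriers.CriticalPhenomena.ScaleNotMoebius.tendsto_mesh_mul_floor (1 : ℝ)).rpow_const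
      (p := 2 * Δ) (Or.inl one_ne_zero)
    rw [Real.one_rpow] at h
    exact h
  have hBne : ∀ᶠ δ in 𝓝[>] (0 : ℝ),
      criticalTwoPoint 3 (Pi.single (0 : Fin 3) ⌊1 / δ⌋) * ((⌊1 / δ⌋ : ℤ) : ℝ) ^ (2 * Δ) ≠ 0 :=
    hB.eventually_ne hc.ne'
  have hIoc : ∀ᶠ δ : ℝ in 𝓝[>] 0, δ ∈ Set.Ioc (0 : ℝ) 1 := Ioc_mem_nhdsGT one_pos
  have hlimit := (hA.div hB hc.ne').mul hC
  rw [mul_one] at hlimit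
  refine hlimit.congr' ?_
  filter_upwards [hBne, hIoc] with δ hne hδ
  have hmpos : (0 : ℝ) < ((⌊1 / δ⌋ : ℤ) : ℝ) := by
    have h1 : (1 : ℤ) ≤ ⌊1 / δ⌋ := Int.le_floor.2 (by rw [Int.cast_one]; exact (one_le_div hδ.1).2 hδ.2)
    exact_mod_cast h1
  have hGne : criticalTwoPoint 3 (Pi.single (0 : Fin 3) ⌊1 / δ⌋) ≠ 0 := fun h0 => hne (by rw [h0, zero_mul])
  have hmne : ((⌊1 / δ⌋ : ℤ) : ℝ) ^ (2 * Δ) ≠ 0 := (Real.rpow_pos_of_pos hmpos _).ne'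
  simp only [Pi.div_apply]
  rw [Real.mul_rpow hδ.1.le hmpos.le]
  field_simp

/-- Hence the canonical ratio converges: `δ^{-Δ}/ρ(δ) → √(c/S₂(0,e₁))`. -/
theorem tendsto_canonical_ratio {Δ c : ℝ} (hc : 0 < c)
    (hP : Tendsto (fun x : Site 3 =>
      criticalTwoPoint 3 x * Real.sqrt (∑ i, ((x i : ℝ)) ^ 2) ^ (2 * Δ)) cofinite (nhds c))
    {ρ : ℝ → ℝ} {S : CorrFamily 3} (hρ : ∀ δ ∈ Set.Ioc (0 : ℝ) 1, 0 < ρ δ)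
    (hlim : HasPointwiseScalingLimit (criticalCorr 3) ρ S) (hnd : IsNondegenerateTwoPoint S) :
    Tendsto (fun δ : ℝ => δ ^ (-Δ) / ρ δ) (𝓝[>] (0 : ℝ))
      (nhds (Real.sqrt (c / S 2 ![0, EuclideanSpace.single (0 : Fin 3) (1 : ℝ)]))) := by
  set s₁ := S 2 ![0, EuclideanSpace.single (0 : Fin 3) (1 : ℝ)] with hs₁
  have hs₁pos : 0 < s₁ := hnd _ (zero_unitVec_mem_nonCoincident one_ne_zero)
  have h := tendsto_rho_sq_mul_rpow hc hP hlim
  have hinv : Tendsto (fun δ : ℝ => (ρ δ ^ 2 * δ ^ (2 * Δ))⁻¹) (𝓝[>] 0) (nhds (c / s₁)) := by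
    have := h.inv₀ (div_pos hs₁pos hc).ne'
    simpa [inv_div] using this
  have hIoc : ∀ᶠ δ : ℝ in 𝓝[>] 0, δ ∈ Set.Ioc (0 : ℝ) 1 := Ioc_mem_nhdsGT one_pos
  have hsq : Tendsto (fun δ : ℝ => (δ ^ (-Δ) / ρ δ) ^ 2) (𝓝[>] 0) (nhds (c / s₁)) := by
    refine hinv.congr' ?_
    filter_upwards [hIoc] with δ hδ
    have hρne : ρ δ ≠ 0 := (hρ δ hδ).ne'
    rw [div_pow, Real.rpow_neg hδ.1.le, inv_pow, ← Real.rpow_mul_natCast hδ.1.le,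
      show Δ * ((2 : ℕ) : ℝ) = 2 * Δ by push_cast; ring, mul_comm (ρ δ ^ 2), mul_inv, div_eq_mul_inv]
  refine hsq.sqrt.congr' ?_
  filter_upwards [hIoc] with δ hδ
  exact Real.sqrt_sq (div_pos (Real.rpow_pos_of_pos hδ.1 _) (hρ δ hδ)).le

end Canonical
section CanonicalForm

/-- `Q` in canonical renormalisation for a prescribed dimension `Δ`: the `δ^{-nΔ}`-renormalised critical
correlators converge to a non-degenerate Möbius-covariant family OF DIMENSION `Δ`. -/
def CanonicalMoebiusLimit (Δ : ℝ) : Prop :=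
  ∃ S : CorrFamily 3, HasPointwiseScalingLimit (criticalCorr 3) (fun δ => δ ^ (-Δ)) S ∧
    IsNondegenerateTwoPoint S ∧ IsMoebiusCovariant Δ S

/-- **Canonical form of the crux.** `MoebiusLimitOfTwoPointLaw` holds iff for every `(Δ, c)` witnessing the
two-point law, `CanonicalMoebiusLimit Δ` holds: the quantifiers `∃ ρ ∃ Δ'` of item 1344 carry no freedom under
item 0634 (`Δ' = Δ` by p68682; `ρ ~ κ δ^{-Δ}` by `tendsto_canonical_ratio`; renormalisations with convergent
ratio are interchangeable by `hasPointwiseScalingLimit_of_ratio_tendsto`). What a prover must produce is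
therefore exactly: convergence of `δ^{-nΔ}⟨σ_{[x₁/δ]}⋯σ_{[xₙ/δ]}⟩_{β_c}` for all `n` along the full filter, and
Möbius covariance of the limit with the two-point exponent `Δ`. -/
theorem crux_iff_canonical :
    MoebiusLimitOfTwoPointLaw ↔
      ∀ Δ c : ℝ, 0 < c →
        Tendsto (fun x : Site 3 =>
          criticalTwoPoint 3 x * Real.sqrt (∑ i, ((x i : ℝ)) ^ 2) ^ (2 * Δ)) cofinite (nhds c) →
        CanonicalMoebiusLimit Δ := by
  constructor
  · intro h Δ c hc hP
    obtain ⟨ρ, Δ', S, hρ, -, hlim, hnd, hM⟩ := h ⟨Δ, c, hc, hP⟩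
    obtain ⟨hΔ, -⟩ := dimension_forced hc hP hρ hlim hnd hM
    subst hΔ
    set μ : ℝ := Real.sqrt (c / S 2 ![0, EuclideanSpace.single (0 : Fin 3) (1 : ℝ)]) with hμ
    have hs : 0 < S 2 ![0, EuclideanSpace.single (0 : Fin 3) (1 : ℝ)] :=
      hnd _ (zero_unitVec_mem_nonCoincident one_ne_zero)
    have hμpos : 0 < μ := Real.sqrt_pos.2 (div_pos hc hs)
    refine ⟨fun n x => μ ^ n * S n x, ?_, ?_, isMoebiusCovariant_const_pow_mul hM⟩
    · exact hasPointwiseScalingLimit_of_ratio_tendsto hlim (fun δ hδ => (hρ δ hδ).ne')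
        (tendsto_canonical_ratio hc hP hρ hlim hnd)
    · intro x hx
      exact mul_pos (pow_pos hμpos 2) (hnd x hx)
  · rintro h ⟨Δ, c, hc, hP⟩
    obtain ⟨S, hlim, hnd, hM⟩ := h Δ c hc hP
    exact ⟨fun δ => δ ^ (-Δ), Δ, S, fun δ hδ => Real.rpow_pos_of_pos hδ.1 _,
      twoPointLaw_exponent_pos hc hP, hlim, hnd, hM⟩

/-- One-exponent reading: if `(Δ, c)` witnesses `P`, the crux is equivalent to `CanonicalMoebiusLimit Δ`
(for THAT `Δ`; any other witness `(Δ₂, c₂)` of `P` has `Δ₂ = Δ`, next lemma). -/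
theorem crux_iff_canonical_at {Δ c : ℝ} (hc : 0 < c)
    (hP : Tendsto (fun x : Site 3 =>
      criticalTwoPoint 3 x * Real.sqrt (∑ i, ((x i : ℝ)) ^ 2) ^ (2 * Δ)) cofinite (nhds c)) :
    MoebiusLimitOfTwoPointLaw ↔ CanonicalMoebiusLimit Δ := by
  rw [crux_iff_canonical]
  constructor
  · exact fun h => h Δ c hc hP
  · intro h Δ₂ c₂ hc₂ hP₂
    have heq : Δ₂ = Δ := twoPointLaw_exponent_unique hc₂ hP₂ hc hP
    subst heq
    exact h
  where
  /-- Two witnesses of `P` have the same exponent (and then the same constant). -/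
  twoPointLaw_exponent_unique {Δ₁ c₁ Δ₂ c₂ : ℝ} (hc₁ : 0 < c₁)
      (h₁ : Tendsto (fun x : Site 3 =>
        criticalTwoPoint 3 x * Real.sqrt (∑ i, ((x i : ℝ)) ^ 2) ^ (2 * Δ₁)) cofinite (nhds c₁))
      (hc₂ : 0 < c₂)
      (h₂ : Tendsto (fun x : Site 3 =>
        criticalTwoPoint 3 x * Real.sqrt (∑ i, ((x i : ℝ)) ^ 2) ^ (2 * Δ₂)) cofinite (nhds c₂)) :
      Δ₁ = Δ₂ := by
    -- along `n e₁`: G n^{2Δ₁} → c₁ and G n^{2Δ₂} → c₂ force n^{2(Δ₁-Δ₂)} → c₁/c₂ ∈ (0,∞), so Δ₁ = Δ₂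
    have g₁ : Tendsto (fun n : ℕ => criticalTwoPoint 3 (Pi.single 0 ((n + 1 : ℕ) : ℤ)) *
        ((n + 1 : ℕ) : ℝ) ^ (2 * Δ₁)) atTop (nhds c₁) := by
      refine (h₁.comp (tendsto_natCast_single_axis_cofinite.comp (tendsto_add_atTop_nat 1))).congr
        fun n => ?_
      simp only [Function.comp_apply]
      rw [sqrt_sum_sq_single_axis, Int.cast_natCast, abs_of_nonneg (Nat.cast_nonneg _)]
    have g₂ : Tendsto (fun n : ℕ => criticalTwoPoint 3 (Pi.single 0 ((n + 1 : ℕ) : ℤ)) *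
        ((n + 1 : ℕ) : ℝ) ^ (2 * Δ₂)) atTop (nhds c₂) := by
      refine (h₂.comp (tendsto_natCast_single_axis_cofinite.comp (tendsto_add_atTop_nat 1))).congr
        fun n => ?_
      simp only [Function.comp_apply]
      rw [sqrt_sum_sq_single_axis, Int.cast_natCast, abs_of_nonneg (Nat.cast_nonneg _)]
    have hratio : Tendsto (fun n : ℕ => ((n + 1 : ℕ) : ℝ) ^ (2 * Δ₁ - 2 * Δ₂)) atTop (nhds (c₁ / c₂)) := by
      have hne : ∀ᶠ n : ℕ in atTop, criticalTwoPoint 3 (Pi.single 0 ((n + 1 : ℕ) : ℤ)) *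
          ((n + 1 : ℕ) : ℝ) ^ (2 * Δ₂) ≠ 0 := g₂.eventually_ne hc₂.ne'
      refine (g₁.div g₂ hc₂.ne').congr' ?_
      filter_upwards [hne] with n hn
      have hpos : (0 : ℝ) < ((n + 1 : ℕ) : ℝ) := by positivity
      have hG : criticalTwoPoint 3 (Pi.single 0 ((n + 1 : ℕ) : ℤ)) ≠ 0 := fun h0 => hn (by rw [h0, zero_mul])
      simp only [Pi.div_apply]
      rw [Real.rpow_sub hpos, mul_div_mul_left _ _ hG]
    have hcast : Tendsto (fun n : ℕ => ((n + 1 : ℕ) : ℝ)) atTop atTop :=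
      tendsto_natCast_atTop_atTop.comp (tendsto_add_atTop_nat 1)
    rcases lt_trichotomy (2 * Δ₁ - 2 * Δ₂) 0 with hlt | heq | hgt
    · exfalso
      have h0 : Tendsto (fun n : ℕ => ((n + 1 : ℕ) : ℝ) ^ (2 * Δ₁ - 2 * Δ₂)) atTop (nhds 0) := by
        have := (tendsto_rpow_neg_atTop (y := -(2 * Δ₁ - 2 * Δ₂)) (by linarith)).comp hcast
        refine this.congr fun n => ?_
        simp
      have := tendsto_nhds_unique hratio h0
      exact (div_pos hc₁ hc₂).ne' this
    · linarith
    · exfalso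
      have hinf : Tendsto (fun n : ℕ => ((n + 1 : ℕ) : ℝ) ^ (2 * Δ₁ - 2 * Δ₂)) atTop atTop :=
        (tendsto_rpow_atTop hgt).comp hcast
      exact hratio.not_tendsto (disjoint_nhds_atTop _) hinf

end CanonicalForm
/-! ### §1d/§1e Re-exports of the landed even-arity reduction -/

/-- Arity `2` is settled by `P` (re-export of `Negative.tendstoLocallyUniformlyOn_arity_two_of_twoPointLaw`). -/
theorem crux_arity_two {Δ c : ℝ} (hc : 0 < c)
    (hP : Tendsto (fun x : Site 3 =>
      criticalTwoPoint 3 x * Real.sqrt (∑ i, ((x i : ℝ)) ^ 2) ^ (2 * Δ)) cofinite (nhds c)) :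
    TendstoLocallyUniformlyOn (rescaledCorrelator (criticalCorr 3) (fun δ => δ ^ (-Δ)) 2)
      (fun x => c * Literature.Barriers.CriticalPhenomena.ScaleNotMoebius.twoPt Δ (x 0) (x 1)) (𝓝[>] (0 : ℝ))
      (NonCoincident 3 2) :=
  Summit.CriticalPhenomena.Ising3DConformalLimit.Theorems.MoebiusLimitOfTwoPointLaw.Negative.tendstoLocallyUniformlyOn_arity_two_of_twoPointLaw
    hc hP

/-- **The irreducible content of the crux** (re-export of `Negative.moebiusLimitOfTwoPointLaw_iff_even`). -/
theorem crux_iff_even :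
    MoebiusLimitOfTwoPointLaw ↔
      ∀ Δ c : ℝ, 0 < c →
        Tendsto (fun x : Site 3 =>
          criticalTwoPoint 3 x * Real.sqrt (∑ i, ((x i : ℝ)) ^ 2) ^ (2 * Δ)) cofinite (nhds c) →
        ∃ T : CorrFamily 3, IsMoebiusCovariant Δ T ∧
          ∀ n, 4 ≤ n → Even n → TendstoLocallyUniformlyOn
            (rescaledCorrelator (criticalCorr 3) (fun δ => δ ^ (-Δ)) n) (T n) (𝓝[>] (0 : ℝ))
            (NonCoincident 3 n) :=
  Summit.CriticalPhenomena.Ising3DConformalLimit.Theorems.MoebiusLimitOfTwoPointLaw.Negative.moebiusLimitOfTwoPointLaw_iff_even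

/-- **The irreducible content of the crux, dilations free** (re-export of
`Negative.moebiusLimitOfTwoPointLaw_iff_even_sharp`). -/
theorem crux_iff_even_sharp :
    MoebiusLimitOfTwoPointLaw ↔
      ∀ Δ c : ℝ, 0 < c →
        Tendsto (fun x : Site 3 =>
          criticalTwoPoint 3 x * Real.sqrt (∑ i, ((x i : ℝ)) ^ 2) ^ (2 * Δ)) cofinite (nhds c) →
        ∃ T : CorrFamily 3,
          (∀ n, 4 ≤ n → Even n → TendstoLocallyUniformlyOn
            (rescaledCorrelator (criticalCorr 3) (fun δ => δ ^ (-Δ)) n) (T n) (𝓝[>] (0 : ℝ))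
            (NonCoincident 3 n)) ∧
          (∀ n, 4 ≤ n → Even n → ∀ (v : EuclideanSpace ℝ (Fin 3)) (x : Fin n → EuclideanSpace ℝ (Fin 3)),
            T n (fun i => x i + v) = T n x) ∧
          (∀ n, 4 ≤ n → Even n → ∀ (R : EuclideanSpace ℝ (Fin 3) ≃ₗᵢ[ℝ] EuclideanSpace ℝ (Fin 3))
            (x : Fin n → EuclideanSpace ℝ (Fin 3)), T n (fun i => R (x i)) = T n x) ∧
          (∀ n, 4 ≤ n → Even n → ∀ x : Fin n → EuclideanSpace ℝ (Fin 3), (∀ i, x i ≠ 0) →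
            T n (fun i => EuclideanGeometry.inversion 0 1 (x i)) = (∏ i, ‖x i‖ ^ (2 * Δ)) * T n x) :=
  Summit.CriticalPhenomena.Ising3DConformalLimit.Theorems.MoebiusLimitOfTwoPointLaw.Negative.moebiusLimitOfTwoPointLaw_iff_even_sharp

/-- **The irreducible content of the crux, translations and dilations free** (re-export of
`Negative.moebiusLimitOfTwoPointLaw_iff_even_sharper`): for every witness `(Δ,c)` of item 0634, a family `T` whose even
arities `n ≥ 4` are the locally uniform canonical limits, `O(3)` invariant and unit-inversion covariant with weight `Δ`.
THIS is what a proof of the crux must supply — nothing more, nothing less. -/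
theorem crux_iff_even_sharper :
    MoebiusLimitOfTwoPointLaw ↔
      ∀ Δ c : ℝ, 0 < c →
        Tendsto (fun x : Site 3 =>
          criticalTwoPoint 3 x * Real.sqrt (∑ i, ((x i : ℝ)) ^ 2) ^ (2 * Δ)) cofinite (nhds c) →
        ∃ T : CorrFamily 3,
          (∀ n, 4 ≤ n → Even n → TendstoLocallyUniformlyOn
            (rescaledCorrelator (criticalCorr 3) (fun δ => δ ^ (-Δ)) n) (T n) (𝓝[>] (0 : ℝ))
            (NonCoincident 3 n)) ∧
          (∀ n, 4 ≤ n → Even n → ∀ (R : EuclideanSpace ℝ (Fin 3) ≃ₗᵢ[ℝ] EuclideanSpace ℝ (Fin 3))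
            (x : Fin n → EuclideanSpace ℝ (Fin 3)), T n (fun i => R (x i)) = T n x) ∧
          (∀ n, 4 ≤ n → Even n → ∀ x : Fin n → EuclideanSpace ℝ (Fin 3), (∀ i, x i ≠ 0) →
            T n (fun i => EuclideanGeometry.inversion 0 1 (x i)) = (∏ i, ‖x i‖ ^ (2 * Δ)) * T n x) :=
  Summit.CriticalPhenomena.Ising3DConformalLimit.Theorems.MoebiusLimitOfTwoPointLaw.Negative.moebiusLimitOfTwoPointLaw_iff_even_sharper

/-! ## §3 Lines under attack (crux-ideate round 1)

The Props below are VERBATIM copies of the first lemmas published in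
`Cruxes/MoebiusLimitOfTwoPointLaw/SketchIdeator2R1.lean` (card `two-shell-exchange-markov`, ideator 2) and
`…/Sketch.lean` (cards `annulus-kelvin-symmetry-scale-axis-gibbs`, `wormhole-contraction-green-engine`,
ideator 1); a holder of the sketch's Prop converts by `Iff.rfl` / `exact`. They are copied, not imported, so that
this file does not depend on work files that ideators may rewrite.

### §3a Card `two-shell-exchange-markov`: the kinematic stubs A1–A3 are TRUE (proved) -/

/-- [copy of `SketchIdeator2R1.IsSphereInversionCovariant`] covariance under `x ↦ λx/‖x‖²`, `λ > 0`. -/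
def IsSphereInversionCovariant (Δ : ℝ) (S : CorrFamily 3) : Prop :=
  ∀ (n : ℕ) (lam : ℝ), 0 < lam → ∀ x : Fin n → E3, (∀ i, x i ≠ 0) →
    S n (fun i => (lam / ‖x i‖ ^ 2) • x i)
      = lam ^ (-(n : ℝ) * Δ) * (∏ i, ‖x i‖ ^ (2 * Δ)) * S n x

/-- [copy of `SketchIdeator2R1.TwoShellExchange`] the two-shell exchange law `E_{k,m}`. -/
def TwoShellExchange (Δ : ℝ) (S : CorrFamily 3) : Prop :=
  ∀ (n : ℕ) (a b : ℝ), 0 < a → 0 < b → ∀ (u : Fin n → E3) (inner : Fin n → Bool),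
    (∀ i, ‖u i‖ = 1) →
      S n (fun i => (if inner i then b else a) • u i)
        = (a / b) ^ ((((Finset.univ.filter fun i => inner i = true).card : ℝ)
              - ((Finset.univ.filter fun i => inner i = false).card : ℝ)) * Δ)
          * S n (fun i => (if inner i then a else b) • u i)

/-- [copy] A1. -/
def KinematicNecessity : Prop :=
  ∀ (Δ : ℝ) (S : CorrFamily 3), IsScaleCovariant Δ S → IsInversionCovariant Δ S →
    IsSphereInversionCovariant Δ S

/-- [copy] A2. -/
def SphereInversionGivesExchange : Prop :=
  ∀ (Δ : ℝ) (S : CorrFamily 3), IsSphereInversionCovariant Δ S → TwoShellExchange Δ S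

/-- [copy] A3. -/
def BaseCaseFromTwoPointLaw : Prop :=
  ∀ (c Δ : ℝ) (S : CorrFamily 3),
    (∀ a b : E3, a ≠ b → S 2 ![a, b] = c * ‖a - b‖ ^ (-(2 * Δ))) →
      ∀ (a b : ℝ), 0 < a → 0 < b → ∀ (u v : E3), ‖u‖ = 1 → ‖v‖ = 1 → a • u ≠ b • v →
        S 2 ![b • u, a • v] = S 2 ![a • u, b • v]

/-- [copy] P2, the group lemma of card A. -/
def GroupLemma : Prop :=
  ∀ (Δ : ℝ) (S : CorrFamily 3),
    (∀ n z, z ∉ NonCoincident 3 n → S n z = 0) →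
    (∀ n, ContinuousOn (S n) (NonCoincident 3 n)) →
    IsTranslationInvariant S → IsSphereInversionCovariant Δ S → IsMoebiusCovariant Δ S

/-- The sphere inversion `x ↦ λx/‖x‖²` is `λ •` the unit inversion of Mathlib. -/
theorem sphereInversion_eq_smul_inversion (lam : ℝ) (x : E3) :
    (lam / ‖x‖ ^ 2) • x = lam • EuclideanGeometry.inversion 0 1 x := by
  rw [EuclideanGeometry.inversion, dist_eq_norm, vsub_eq_sub, sub_zero, vadd_eq_add, add_zero,
    smul_smul]
  congr 1
  rw [div_pow, one_pow]
  ring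

/-- Norm of the sphere-inverted point: `‖λx/‖x‖²‖ = λ/‖x‖` (`λ > 0`, `x ≠ 0`). -/
theorem norm_sphereInversion {lam : ℝ} (hlam : 0 < lam) {x : E3} (hx : x ≠ 0) :
    ‖(lam / ‖x‖ ^ 2) • x‖ = lam / ‖x‖ := by
  have hn : 0 < ‖x‖ := norm_pos_iff.2 hx
  rw [norm_smul, Real.norm_eq_abs, abs_of_pos (by positivity)]
  field_simp

/-- The sphere inversion is injective on nonzero vectors (for `λ ≠ 0`). -/
theorem sphereInversion_injective {lam : ℝ} (hlam : lam ≠ 0) {x y : E3}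
    (h : (lam / ‖x‖ ^ 2) • x = (lam / ‖y‖ ^ 2) • y) : x = y := by
  rw [sphereInversion_eq_smul_inversion, sphereInversion_eq_smul_inversion] at h
  exact EuclideanGeometry.inversion_injective (0 : E3) one_ne_zero (smul_right_injective E3 hlam h)

/-- **A1 is TRUE.** Scale covariance + unit-inversion covariance ⇒ covariance under every origin-centred
sphere inversion (`ι_λ = λ • ι₁`). -/
theorem kinematicNecessity : KinematicNecessity := by
  intro Δ S hsc hinv n lam hlam x hx
  have h1 : (fun i => (lam / ‖x i‖ ^ 2) • x i) =
      fun i => lam • EuclideanGeometry.inversion 0 1 (x i) := by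
    funext i; exact sphereInversion_eq_smul_inversion lam (x i)
  rw [h1, hsc n lam hlam (fun i => EuclideanGeometry.inversion 0 1 (x i)), hinv n x hx, mul_assoc]

/-- **A2 is TRUE.** Sphere-inversion covariance ⇒ the two-shell exchange law (`ι_{ab}` swaps the shells
of radii `a` and `b`; the weight is `(ab)^{-nΔ} a^{2kΔ} b^{2mΔ} = (a/b)^{(k-m)Δ}`). -/
theorem sphereInversionGivesExchange : SphereInversionGivesExchange := by
  intro Δ S hS n a b ha hb u inner hu
  -- the configuration with inner points at radius `a`, outer at radius `b`
  set y : Fin n → E3 := fun i => (if inner i then a else b) • u i with hy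
  have hny : ∀ i, ‖y i‖ = if inner i then a else b := by
    intro i
    simp only [hy]
    split_ifs with h
    · rw [norm_smul, Real.norm_eq_abs, abs_of_pos ha, hu i, mul_one]
    · rw [norm_smul, Real.norm_eq_abs, abs_of_pos hb, hu i, mul_one]
  have hy0 : ∀ i, y i ≠ 0 := by
    intro i
    rw [← norm_pos_iff, hny i]
    split_ifs <;> assumption
  have key := hS n (a * b) (mul_pos ha hb) y hy0
  -- `ι_{ab} y` is the exchanged configuration
  have himg : (fun i => (a * b / ‖y i‖ ^ 2) • y i) = fun i => (if inner i then b else a) • u i := by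
    funext i
    rw [hny i]
    simp only [hy]
    split_ifs with h
    · rw [smul_smul]; congr 1; field_simp
    · rw [smul_smul]; congr 1; field_simp
  rw [himg] at key
  rw [key]
  congr 1
  -- the weight
  have hprod : (∏ i, ‖y i‖ ^ (2 * Δ)) =
      (a ^ (2 * Δ)) ^ (Finset.univ.filter fun i => inner i = true).card *
        (b ^ (2 * Δ)) ^ (Finset.univ.filter fun i => inner i = false).card := by
    have h1 : (∏ i, ‖y i‖ ^ (2 * Δ)) = ∏ i, (if inner i = true then a ^ (2 * Δ) else b ^ (2 * Δ)) := by
      refine Finset.prod_congr rfl fun i _ => ?_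
      rw [hny i]
      split_ifs <;> rfl
    rw [h1, Finset.prod_ite, Finset.prod_const, Finset.prod_const]
    simp only [Bool.not_eq_true]
  set k : ℕ := (Finset.univ.filter fun i => inner i = true).card with hk
  set m : ℕ := (Finset.univ.filter fun i => inner i = false).card with hm
  have hkm : (k : ℝ) + m = n := by
    have h := Finset.card_filter_add_card_filter_not (s := (Finset.univ : Finset (Fin n)))
      (fun i => inner i = true)
    simp only [Finset.card_univ, Fintype.card_fin, Bool.not_eq_true] at h
    rw [← hk, ← hm] at h
    exact_mod_cast h
  rw [hprod, ← Real.rpow_mul_natCast ha.le, ← Real.rpow_mul_natCast hb.le,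
    Real.mul_rpow ha.le hb.le]
  have e1 : -(n : ℝ) * Δ + 2 * Δ * k = (k - m) * Δ := by rw [← hkm]; ring
  have e2 : -(n : ℝ) * Δ + 2 * Δ * m = -((k - m) * Δ) := by rw [← hkm]; ring
  calc a ^ (-(n : ℝ) * Δ) * b ^ (-(n : ℝ) * Δ) * (a ^ (2 * Δ * k) * b ^ (2 * Δ * m))
      = (a ^ (-(n : ℝ) * Δ) * a ^ (2 * Δ * k)) * (b ^ (-(n : ℝ) * Δ) * b ^ (2 * Δ * m)) := by ring
    _ = a ^ ((k - m) * Δ) * b ^ (-((k - m) * Δ)) := by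
        rw [← Real.rpow_add ha, ← Real.rpow_add hb, e1, e2]
    _ = (a / b) ^ (((k : ℝ) - m) * Δ) := by
        rw [Real.rpow_neg hb.le, Real.div_rpow ha.le hb.le, div_eq_mul_inv]

/-- `‖b u − a v‖ = ‖a u − b v‖` for unit `u, v`. -/
theorem norm_exchange_units (a b : ℝ) {u v : E3} (hu : ‖u‖ = 1) (hv : ‖v‖ = 1) :
    ‖b • u - a • v‖ = ‖a • u - b • v‖ := by
  have h1 : ‖b • u - a • v‖ ^ 2 = ‖a • u - b • v‖ ^ 2 := by
    rw [@norm_sub_sq_real, @norm_sub_sq_real, norm_smul, norm_smul, norm_smul, norm_smul, hu, hv,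
      real_inner_smul_left, real_inner_smul_right, real_inner_smul_left, real_inner_smul_right]
    simp only [Real.norm_eq_abs, mul_one, sq_abs]
    ring
  exact (pow_left_inj₀ (norm_nonneg _) (norm_nonneg _) two_ne_zero).1 h1

/-- **A3 is TRUE.** The exact two-point law gives the `(1,1)` member of the hierarchy. -/
theorem baseCaseFromTwoPointLaw : BaseCaseFromTwoPointLaw := by
  intro c Δ S hS a b ha hb u v hu hv hne
  have hnorm := norm_exchange_units a b hu hv
  have hne' : b • u ≠ a • v := by
    intro h
    apply hne
    rw [← sub_eq_zero, ← norm_eq_zero, ← hnorm, norm_eq_zero, sub_eq_zero]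
    exact h
  rw [hS _ _ hne', hS _ _ hne, hnorm]
/-! ### §3b Card `two-shell-exchange-markov`: translation invariance is LOAD-BEARING in the group lemma P2

`GroupLemma` (P2) asks: normalised + continuous off the diagonals + translation invariant + covariant under
every origin-centred sphere inversion ⇒ Möbius covariant. Drop translation invariance and it is FALSE, for
every weight `Δ`: the two-point family
`A_Δ(x,y) = ‖x−y‖^{-2Δ} · (1 + (⟪x,e₁⟫‖y‖ + ⟪y,e₁⟫‖x‖)/(‖x‖² + ‖y‖²))`
(zero on the diagonal, all other arities zero) is continuous off the diagonal, covariant under EVERY `ι_λ`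
(the angular factor is `ι_λ`- and dilation-invariant), hence also scale covariant with dimension `Δ`, but it
is not `O(3)` invariant (`x ↦ −x` flips the sign of the anisotropy; so does the rotation by `π` about `e₃`).
Moral for the line: the `O(3)` half of P2 comes from CONJUGATING `ι` by translations; sphere inversions about
ONE centre generate (with dilations) only an abelian group preserving every ray direction. -/

/-- `GroupLemma` with the hypothesis `IsTranslationInvariant S` deleted. Refuted below. -/
def GroupLemmaWithoutTranslation : Prop :=
  ∀ (Δ : ℝ) (S : CorrFamily 3),
    (∀ n z, z ∉ NonCoincident 3 n → S n z = 0) →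
    (∀ n, ContinuousOn (S n) (NonCoincident 3 n)) →
    IsSphereInversionCovariant Δ S → IsMoebiusCovariant Δ S

open Literature.Barriers.CriticalPhenomena.ScaleNotMoebius (twoPt twoPt_pos twoPt_smul twoPt_inversion
  twoPt_map axisUnit norm_axisUnit axisUnit_ne_zero injective_fin_two_iff continuousOn_twoPt)

/-- The anisotropy factor `1 + (⟪x,e₁⟫‖y‖ + ⟪y,e₁⟫‖x‖)/(‖x‖² + ‖y‖²)` — invariant under every origin-centred
sphere inversion and every dilation, continuous off `(0,0)`, odd part flipped by `x ↦ −x`. -/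
def aniso (x y : E3) : ℝ := 1 + (inner ℝ x axisUnit * ‖y‖ + inner ℝ y axisUnit * ‖x‖) / (‖x‖ ^ 2 + ‖y‖ ^ 2)

/-- The anisotropic two-point function `‖x−y‖^{-2Δ} · aniso x y` (zero on the diagonal). -/
def anisoPair (Δ : ℝ) (x y : E3) : ℝ := if x = y then 0 else twoPt Δ x y * aniso x y

/-- The witness family: `anisoPair Δ` at `n = 2`, zero in every other arity. -/
def anisoFamily (Δ : ℝ) : CorrFamily 3 := fun n =>
  match n with
  | 2 => fun x => anisoPair Δ (x 0) (x 1)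
  | _ => fun _ => 0

/-- The witness at arity `2`. -/
theorem anisoFamily_two (Δ : ℝ) (x : Fin 2 → E3) : anisoFamily Δ 2 x = anisoPair Δ (x 0) (x 1) := rfl

/-- The witness vanishes in every arity `≠ 2`. -/
theorem anisoFamily_ne_two (Δ : ℝ) {n : ℕ} (hn : n ≠ 2) (x : Fin n → E3) : anisoFamily Δ n x = 0 := by
  match n, hn with
  | 0, _ => rfl
  | 1, _ => rfl
  | 2, h => exact absurd rfl h
  | n + 3, _ => rfl

/-- Normalisation: the witness vanishes off `NonCoincident`. -/
theorem anisoFamily_eq_zero_of_not_mem (Δ : ℝ) (n : ℕ) (z : Fin n → E3) (hz : z ∉ NonCoincident 3 n) :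
    anisoFamily Δ n z = 0 := by
  by_cases hn : n = 2
  · subst hn
    rw [anisoFamily_two, anisoPair, if_pos]
    by_contra h01
    exact hz ((mem_nonCoincident z).2 ((injective_fin_two_iff z).2 h01))
  · exact anisoFamily_ne_two Δ hn z

/-- `aniso` is continuous off the doubly-degenerate point `x = y = 0`, in particular off the diagonal. -/
theorem continuousOn_aniso :
    ContinuousOn (fun x : Fin 2 → E3 => aniso (x 0) (x 1)) {x | x 0 ≠ x 1} := by
  unfold aniso
  refine continuousOn_const.add (ContinuousOn.div ?_ ?_ ?_)
  · fun_prop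
  · fun_prop
  · intro x hx h0
    have h1 : ‖x 0‖ ^ 2 = 0 := by nlinarith [sq_nonneg ‖x 0‖, sq_nonneg ‖x 1‖]
    have h2 : ‖x 1‖ ^ 2 = 0 := by nlinarith [sq_nonneg ‖x 0‖, sq_nonneg ‖x 1‖]
    rw [sq_eq_zero_iff, norm_eq_zero] at h1 h2
    exact hx (h1.trans h2.symm)

/-- Continuity of the witness on non-coincident configurations, every arity. -/
theorem continuousOn_anisoFamily (Δ : ℝ) (n : ℕ) :
    ContinuousOn (anisoFamily Δ n) (NonCoincident 3 n) := by
  by_cases hn : n = 2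
  · subst hn
    have hset : NonCoincident 3 2 = {x : Fin 2 → E3 | x 0 ≠ x 1} := by
      ext x; rw [mem_nonCoincident, injective_fin_two_iff]; rfl
    rw [hset]
    refine ((continuousOn_twoPt Δ (0 : Fin 2) 1).mul continuousOn_aniso).congr fun x hx => ?_
    rw [anisoFamily_two, anisoPair, if_neg hx]
    rfl
  · refine (continuousOn_const (c := (0 : ℝ))).congr fun x _ => ?_
    exact anisoFamily_ne_two Δ hn x

/-- `aniso` is invariant under every origin-centred sphere inversion. -/
theorem aniso_sphereInversion {lam : ℝ} (hlam : 0 < lam) {x y : E3} (hx : x ≠ 0) (hy : y ≠ 0) :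
    aniso ((lam / ‖x‖ ^ 2) • x) ((lam / ‖y‖ ^ 2) • y) = aniso x y := by
  unfold aniso
  have hnx : 0 < ‖x‖ := norm_pos_iff.2 hx
  have hny : 0 < ‖y‖ := norm_pos_iff.2 hy
  rw [norm_sphereInversion hlam hx, norm_sphereInversion hlam hy, real_inner_smul_left,
    real_inner_smul_left]
  congr 1
  field_simp
  ring

/-- `aniso` is dilation invariant. -/
theorem aniso_smul {c : ℝ} (hc : 0 < c) (x y : E3) : aniso (c • x) (c • y) = aniso x y := by
  unfold aniso
  by_cases h : ‖x‖ ^ 2 + ‖y‖ ^ 2 = 0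
  · have h1 : ‖x‖ ^ 2 = 0 := by nlinarith [sq_nonneg ‖x‖, sq_nonneg ‖y‖]
    have h2 : ‖y‖ ^ 2 = 0 := by nlinarith [sq_nonneg ‖x‖, sq_nonneg ‖y‖]
    rw [sq_eq_zero_iff, norm_eq_zero] at h1 h2
    subst h1; subst h2
    simp
  · rw [norm_smul, norm_smul, real_inner_smul_left, real_inner_smul_left, Real.norm_eq_abs,
      abs_of_pos hc]
    congr 1
    have hc0 : c ≠ 0 := hc.ne'
    field_simp

/-- **The witness is covariant under every origin-centred sphere inversion**, weight `Δ`. -/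
theorem anisoFamily_isSphereInversionCovariant (Δ : ℝ) :
    IsSphereInversionCovariant Δ (anisoFamily Δ) := by
  intro n lam hlam x hx
  by_cases hn : n = 2
  · subst hn
    rw [anisoFamily_two, anisoFamily_two, anisoPair, anisoPair]
    by_cases h01 : x 0 = x 1
    · -- diagonal: both sides vanish
      rw [if_pos (by rw [h01]), if_pos h01, mul_zero]
    · have h01' : (lam / ‖x 0‖ ^ 2) • x 0 ≠ (lam / ‖x 1‖ ^ 2) • x 1 :=
        fun h => h01 (sphereInversion_injective hlam.ne' h)
      rw [if_neg h01', if_neg h01, aniso_sphereInversion hlam (hx 0) (hx 1),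
        sphereInversion_eq_smul_inversion, sphereInversion_eq_smul_inversion, twoPt_smul Δ hlam,
        twoPt_inversion Δ (hx 0) (hx 1), Fin.prod_univ_two]
      have e : (-((2 : ℕ) : ℝ) * Δ) = -(2 * Δ) := by push_cast; ring
      rw [e]
      ring
  · rw [anisoFamily_ne_two Δ hn, anisoFamily_ne_two Δ hn, mul_zero]

/-- The witness is moreover scale covariant with dimension `Δ` (so P2 minus translations fails even with
scale covariance thrown in). -/
theorem anisoFamily_isScaleCovariant (Δ : ℝ) : IsScaleCovariant Δ (anisoFamily Δ) := by
  intro n c hc x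
  by_cases hn : n = 2
  · subst hn
    rw [anisoFamily_two, anisoFamily_two, anisoPair, anisoPair]
    by_cases h01 : x 0 = x 1
    · rw [if_pos (by rw [h01]), if_pos h01, mul_zero]
    · have h01' : c • x 0 ≠ c • x 1 := fun h => h01 (smul_right_injective E3 hc.ne' h)
      rw [if_neg h01', if_neg h01, aniso_smul hc, twoPt_smul Δ hc]
      have e : (-((2 : ℕ) : ℝ) * Δ) = -(2 * Δ) := by push_cast; ring
      rw [e]
      ring
  · rw [anisoFamily_ne_two Δ hn, anisoFamily_ne_two Δ hn, mul_zero]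

/-- The test pair `(e₁, 2e₁)`. -/
def testPair : Fin 2 → E3 := ![axisUnit, (2 : ℝ) • axisUnit]

/-- First point of the test pair. -/
theorem testPair_zero : testPair 0 = axisUnit := rfl
/-- Second point of the test pair. -/
theorem testPair_one : testPair 1 = (2 : ℝ) • axisUnit := rfl

/-- `e₁ ≠ 2e₁`. -/
theorem axisUnit_ne_two_smul : axisUnit ≠ (2 : ℝ) • axisUnit := by
  intro h
  have h2 : (1 : ℝ) • axisUnit = (2 : ℝ) • axisUnit := by rwa [one_smul]
  have := smul_left_injective ℝ axisUnit_ne_zero h2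
  norm_num at this

/-- `⟪e₁, e₁⟫ = 1`. -/
theorem inner_axisUnit_self : inner ℝ axisUnit axisUnit = (1 : ℝ) := by
  rw [real_inner_self_eq_norm_sq, norm_axisUnit, one_pow]

/-- `aniso (e₁, 2e₁) = 9/5`. -/
theorem aniso_testPair : aniso axisUnit ((2 : ℝ) • axisUnit) = 9 / 5 := by
  unfold aniso
  rw [norm_smul, real_inner_smul_left, inner_axisUnit_self, norm_axisUnit, Real.norm_eq_abs,
    abs_of_pos two_pos]
  norm_num

/-- `aniso (−e₁, −2e₁) = 1/5`. -/
theorem aniso_neg_testPair : aniso (-axisUnit) (-((2 : ℝ) • axisUnit)) = 1 / 5 := by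
  unfold aniso
  rw [norm_neg, norm_neg, norm_smul, inner_neg_left, inner_neg_left, real_inner_smul_left,
    inner_axisUnit_self, norm_axisUnit, Real.norm_eq_abs, abs_of_pos two_pos]
  norm_num

/-- The reflected test pair `(−e₁, −2e₁)`. -/
def negTestPair : Fin 2 → E3 := ![-axisUnit, -((2 : ℝ) • axisUnit)]

/-- `S₂(e₁, 2e₁) = (9/5)·‖e₁‖^{-2Δ}` but `S₂(−e₁, −2e₁) = (1/5)·‖e₁‖^{-2Δ}`: the values differ. -/
theorem anisoFamily_negTestPair_ne (Δ : ℝ) : anisoFamily Δ 2 negTestPair ≠ anisoFamily Δ 2 testPair := by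
  intro key
  rw [anisoFamily_two, anisoFamily_two] at key
  simp only [negTestPair, testPair, Matrix.cons_val_zero, Matrix.cons_val_one] at key
  rw [anisoPair, anisoPair, if_neg (neg_injective.ne axisUnit_ne_two_smul), if_neg axisUnit_ne_two_smul,
    aniso_neg_testPair, aniso_testPair] at key
  have ht : twoPt Δ (-axisUnit) (-((2 : ℝ) • axisUnit)) = twoPt Δ axisUnit ((2 : ℝ) • axisUnit) := by
    have := twoPt_map Δ (LinearIsometryEquiv.neg ℝ) axisUnit ((2 : ℝ) • axisUnit)
    simpa using this
  rw [ht] at key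
  have hpos : 0 < twoPt Δ axisUnit ((2 : ℝ) • axisUnit) := twoPt_pos Δ axisUnit_ne_two_smul
  have : (1 / 5 : ℝ) = 9 / 5 := by
    have := mul_left_cancel₀ hpos.ne' key
    linarith
  norm_num at this

/-- **The witness is NOT `O(3)` invariant**: already the point reflection `x ↦ −x` (a linear isometry of
`ℝ³`, an element of `O(3)`) maps `(e₁, 2e₁)` to `(−e₁, −2e₁)`. -/
theorem anisoFamily_not_isRotationInvariant (Δ : ℝ) : ¬ IsRotationInvariant (anisoFamily Δ) := by
  intro h
  have key := h 2 (LinearIsometryEquiv.neg ℝ) testPair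
  have hcfg : (fun i => (LinearIsometryEquiv.neg ℝ : E3 ≃ₗᵢ[ℝ] E3) (testPair i)) = negTestPair := by
    funext i
    fin_cases i <;> simp [testPair, negTestPair]
  rw [hcfg] at key
  exact anisoFamily_negTestPair_ne Δ key

/-- The same failure under a PROPER rotation: the half-turn about `e₃` (`e₁ ↦ −e₁`, `e₂ ↦ −e₂`, `e₃ ↦ e₃`;
realised as the product of the reflections in the planes `⟂ e₁` and `⟂ e₂`) also sends `(e₁, 2e₁)` to
`(−e₁, −2e₁)`. So the obstruction is not an orientation artefact of `O(3)` versus `SO(3)`. -/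
theorem anisoFamily_not_invariant_halfTurn (Δ : ℝ) :
    ∃ R : E3 ≃ₗᵢ[ℝ] E3,
      R (EuclideanSpace.single 0 1) = -EuclideanSpace.single 0 1 ∧
      R (EuclideanSpace.single 1 1) = -EuclideanSpace.single 1 1 ∧
      R (EuclideanSpace.single 2 1) = EuclideanSpace.single 2 1 ∧
      anisoFamily Δ 2 (fun i => R (testPair i)) ≠ anisoFamily Δ 2 testPair := by
  set e₁ : E3 := EuclideanSpace.single 0 1 with he₁
  set e₂ : E3 := EuclideanSpace.single 1 1 with he₂
  set e₃ : E3 := EuclideanSpace.single 2 1 with he₃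
  let R₁ : E3 ≃ₗᵢ[ℝ] E3 := (ℝ ∙ e₁)ᗮ.reflection
  let R₂ : E3 ≃ₗᵢ[ℝ] E3 := (ℝ ∙ e₂)ᗮ.reflection
  have h11 : R₁ e₁ = -e₁ := Submodule.reflection_orthogonalComplement_singleton_eq_neg e₁
  have h22 : R₂ e₂ = -e₂ := Submodule.reflection_orthogonalComplement_singleton_eq_neg e₂
  have mem12 : e₂ ∈ (ℝ ∙ e₁)ᗮ := by
    rw [Submodule.mem_orthogonal_singleton_iff_inner_right, he₁, he₂, EuclideanSpace.inner_single_left]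
    simp
  have mem13 : e₃ ∈ (ℝ ∙ e₁)ᗮ := by
    rw [Submodule.mem_orthogonal_singleton_iff_inner_right, he₁, he₃, EuclideanSpace.inner_single_left]
    simp
  have mem21 : e₁ ∈ (ℝ ∙ e₂)ᗮ := by
    rw [Submodule.mem_orthogonal_singleton_iff_inner_right, he₁, he₂, EuclideanSpace.inner_single_left]
    simp
  have mem23 : e₃ ∈ (ℝ ∙ e₂)ᗮ := by
    rw [Submodule.mem_orthogonal_singleton_iff_inner_right, he₂, he₃, EuclideanSpace.inner_single_left]
    simp
  have h12 : R₁ e₂ = e₂ := Submodule.reflection_mem_subspace_eq_self mem12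
  have h13 : R₁ e₃ = e₃ := Submodule.reflection_mem_subspace_eq_self mem13
  have h21 : R₂ e₁ = e₁ := Submodule.reflection_mem_subspace_eq_self mem21
  have h23 : R₂ e₃ = e₃ := Submodule.reflection_mem_subspace_eq_self mem23
  refine ⟨R₁.trans R₂, ?_, ?_, ?_, ?_⟩
  · simp only [LinearIsometryEquiv.trans_apply]; rw [h11, map_neg, h21]
  · simp only [LinearIsometryEquiv.trans_apply]; rw [h12, h22]
  · simp only [LinearIsometryEquiv.trans_apply]; rw [h13, h23]
  · have hax : axisUnit = e₁ := rfl
    have hcfg : (fun i => (R₁.trans R₂) (testPair i)) = negTestPair := by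
      funext i
      fin_cases i
      · simp only [LinearIsometryEquiv.trans_apply, testPair, negTestPair, Fin.zero_eta, Matrix.cons_val_zero]
        rw [hax, h11, map_neg, h21]
      · simp only [LinearIsometryEquiv.trans_apply, testPair, negTestPair, Fin.mk_one, Matrix.cons_val_one,
          Matrix.cons_val_zero, map_smul]
        rw [hax, h11, map_neg, h21, smul_neg]
    rw [hcfg]
    exact anisoFamily_negTestPair_ne Δ

/-- The witness is (of course) not translation invariant: `S₂(0, e₁) = ‖e₁‖^{-2Δ}` while
`S₂(e₁, 2e₁) = (9/5)‖e₁‖^{-2Δ}`. -/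
theorem anisoFamily_not_isTranslationInvariant (Δ : ℝ) : ¬ IsTranslationInvariant (anisoFamily Δ) := by
  intro h
  have key := h 2 (-axisUnit) testPair
  rw [anisoFamily_two, anisoFamily_two] at key
  simp only [testPair, Matrix.cons_val_zero, Matrix.cons_val_one] at key
  have h0 : axisUnit + -axisUnit = (0 : E3) := add_neg_cancel axisUnit
  have h1 : (2 : ℝ) • axisUnit + -axisUnit = axisUnit := by
    rw [← sub_eq_add_neg, show (2 : ℝ) • axisUnit - axisUnit = (2 - 1 : ℝ) • axisUnit by
      rw [sub_smul, one_smul]]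
    norm_num
  rw [h0, h1, anisoPair, anisoPair, if_neg axisUnit_ne_zero.symm, if_neg axisUnit_ne_two_smul,
    aniso_testPair] at key
  have ha0 : aniso 0 axisUnit = 1 := by unfold aniso; simp
  rw [ha0] at key
  have ht : twoPt Δ 0 axisUnit = twoPt Δ axisUnit ((2 : ℝ) • axisUnit) := by
    have := Literature.Barriers.CriticalPhenomena.ScaleNotMoebius.twoPt_add Δ axisUnit ((2 : ℝ) • axisUnit)
      (-axisUnit)
    rw [h0, h1] at this
    exact this
  rw [ht] at key
  have hpos : 0 < twoPt Δ axisUnit ((2 : ℝ) • axisUnit) := twoPt_pos Δ axisUnit_ne_two_smul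
  have : (1 : ℝ) = 9 / 5 := mul_left_cancel₀ hpos.ne' key
  norm_num at this

/-- **P2 needs translation invariance** (`GroupLemmaWithoutTranslation` refuted, at the Ising-window
weight `Δ = 1/2`; the witness works for every `Δ`, next theorem). -/
theorem not_groupLemmaWithoutTranslation : ¬ GroupLemmaWithoutTranslation := fun h =>
  anisoFamily_not_isRotationInvariant (1 / 2)
    (h (1 / 2) (anisoFamily (1 / 2)) (anisoFamily_eq_zero_of_not_mem _) (continuousOn_anisoFamily _)
      (anisoFamily_isSphereInversionCovariant _)).1.2

/-- Per-weight form: for EVERY `Δ`, the family `anisoFamily Δ` satisfies all hypotheses of P2 except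
translation invariance — and scale covariance on top — yet is not Möbius covariant. -/
theorem groupLemma_hypotheses_without_translation_insufficient (Δ : ℝ) :
    (∀ n z, z ∉ NonCoincident 3 n → anisoFamily Δ n z = 0) ∧
    (∀ n, ContinuousOn (anisoFamily Δ n) (NonCoincident 3 n)) ∧
    IsSphereInversionCovariant Δ (anisoFamily Δ) ∧ IsScaleCovariant Δ (anisoFamily Δ) ∧
    ¬ IsMoebiusCovariant Δ (anisoFamily Δ) :=
  ⟨anisoFamily_eq_zero_of_not_mem Δ, continuousOn_anisoFamily Δ, anisoFamily_isSphereInversionCovariant Δ,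
    anisoFamily_isScaleCovariant Δ, fun h => anisoFamily_not_isRotationInvariant Δ h.1.2⟩
/-! ### §3c Card `two-shell-exchange-markov`: what the exchange hierarchy decides, arity by arity
(paper analysis, not kernel-checked; for the crux-plan seat)

`E_{k,m}` is inversion covariance RESTRICTED to configurations lying on two concentric spheres (about the
origin; about ANY centre once translations are in, which K1's setting has). Fix `n` and write
`S_n = W_n · F_n` with `W_n` any nowhere-vanishing Möbius-covariant weight of dimension `Δ` per point (e.g. the
Wick sum of `‖x_i−x_j‖^{-2Δ}`, `> 0`); then `S_n` is inversion covariant iff `F_n` is Möbius INVARIANT, and each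
exchange identity says `F_n(ι_{c,ab} x) = F_n(x)` whenever `x` is two-shell about `c` with radii `a, b`
("admissible move"; weight-free bookkeeping because `W_n` absorbs the factor exactly).

* `n ≤ 4`: EXCHANGE SUFFICES (no Markov input needed). For a generic 4-point `x` the admissible centres for the
  pairing `{i,j} | {k,l}` form the line `ℓ = bis(x_i,x_j) ∩ bis(x_k,x_l)`, which passes through the circumcentre
  `c₀` of `x` (4 generic points of `ℝ³` are cospherical), where `a = b` and the move is the identity. Moving `c`
  along `ℓ` through `c₀` gives a one-parameter family of moves through the identity with generator (positions
  `y_i = x_i − c₀`, `‖y_i‖ = R`): `V_{ij|kl} = (y_i, y_j, −y_k, −y_l)` up to a generically non-zero scalar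
  `(⟨y_i,d⟩ − ⟨y_k,d⟩)/R²`, `d ∥ ℓ`. The three pairings and the dilation `D = (y_0,y_1,y_2,y_3)` span ALL
  independent radial motions `(ε_0 y_0, …, ε_3 y_3)`. On the other hand the special conformal generator
  `K_b(y) = 2⟨b,y⟩y − ‖y‖²b` restricted to the sphere `‖y‖ = R` is `K_b(y_i) = −R²b + 2⟨b,y_i⟩ y_i`: a common
  translation plus the radial motion with amplitudes `2⟨b,y_i⟩`; as `b` ranges over `ℝ³` and with `D`, these
  amplitudes `{(⟨b,y_i⟩)_i} + ℝ(1,1,1,1)` fill `ℝ⁴` iff the `y_i` are not coplanar (generic). Hence at generic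
  `x`: T_x(Möbius orbit) = similarities + span{V} — the admissible moves together with translations, rotations
  and dilations generate the full local Möbius action, so a continuous `F_4` that is similarity invariant and
  exchange invariant is locally constant on Möbius orbits off a closed semialgebraic set of positive
  codimension, and constant on whole orbits by continuity across the strata: **Euclid + scale + continuity +
  `E_{2,2}` about all centres ⇒ inversion covariance of `S_4`.** [rank claim CONFIRMED in exact arithmetic at three
  configurations incl. the tetrahedron `(0,e₁,e₂,e₃)`: rank(similarities) = 7, rank(sims + admissible moves) =
  rank(sims + special conformal) = rank(all) = 10 — `cas/rank_n4.py`, item evidence `output_rank_n4.txt`] (For `n ≤ 3` Möbius covariance is automatic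
  from Euclid + scale + the pure-power `S₂`; `S₃` vanishes for Ising.) Consequence for the line: clause (ii) AT
  `n = 4` is equivalent, given a regular Euclidean scale-covariant limit, to the family of weight-free lattice-
  testable identities `E_{2,2}` — exactly what job j006843 (§4) measures; K2 (Markov lift) is not needed at `n = 4`
  but K1 must then deliver `E_{2,2}` about every centre AND the line still owes `O(3)` for `S_4` (K1 as typed
  assumes no rotation invariance; the rank count above used rotations as available similarities).
* `n = 5`: generically FINITELY many admissible centres (`(1,4)`: circumcentre of the four; `(2,3)`: bisector
  plane ∩ axis of the triple), all with `a ≠ b`: the moves are finite jumps, no infinitesimal generator; whether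
  the generated discrete relations plus continuity force Möbius invariance of `F_5` is OPEN here (irrelevant for
  Ising, `S_5 = 0`).
* `n ≥ 6`: a GENERIC configuration is two-shell about NO centre (`(3,3)`: two generic lines of `ℝ³` do not
  meet; `(2,4)`: a generic plane misses the circumcentre; `(1,5)`: five generic points are not cospherical), so
  `TwoShellExchange Δ S` imposes NO relation on `S_6, S_8, …` at generic configurations while
  `IsSphereInversionCovariant` relates them: everything `n ≥ 6` in `MarkovLift` (K2) must come from the
  Markov/trace structure ("in law … + Markov ⇒ reversible"), not from the displayed hierarchy.

### §3d Card `multipole-ward-nonsat-endpoint`: glue B1 is TRUE (proved) -/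

/-- [verbatim copy of `SketchIdeator2R1.NonSaturationCopy` = `PerfectScreening.NonSaturation`, item 1342]
non-saturation of the infrared bound along the first axis: `liminf n·⟨σ₀σ_{ne₁}⟩_{β_c} = 0`. -/
def NonSaturationCopy : Prop :=
  ∀ ε : ℝ, 0 < ε → ∃ᶠ n : ℕ in Filter.atTop,
    (n : ℝ) * criticalTwoPoint 3 (Pi.single 0 (n : ℤ)) < ε

/-- [copy] B1. -/
def StrictEtaFromNonSat : Prop :=
  NonSaturationCopy →
  ∀ Δ c : ℝ, 0 < c →
    Filter.Tendsto (fun x : Site 3 =>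
      criticalTwoPoint 3 x * Real.sqrt (∑ i, ((x i : ℝ)) ^ 2) ^ (2 * Δ)) Filter.cofinite (nhds c) →
    1 / 2 < Δ

/-- **B1 is TRUE.** If `Δ ≤ 1/2` then along `n e₁`, `n·G(ne₁) = (G(ne₁) n^{2Δ})·n^{1−2Δ} ≥ c/2` eventually,
contradicting non-saturation. (No tree fact needed beyond the hypothesis.) -/
theorem strictEtaFromNonSat : StrictEtaFromNonSat := by
  intro hNS Δ c hc hP
  by_contra hle
  push Not at hle
  -- the law along the axis `n e₁`
  have hseq : Tendsto (fun n : ℕ => criticalTwoPoint 3 (Pi.single 0 (n : ℤ)) * (n : ℝ) ^ (2 * Δ))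
      atTop (nhds c) := by
    refine (hP.comp tendsto_natCast_single_axis_cofinite).congr fun n => ?_
    simp only [Function.comp_apply]
    rw [sqrt_sum_sq_single_axis, Int.cast_natCast, abs_of_nonneg (Nat.cast_nonneg n)]
  have hev : ∀ᶠ n : ℕ in atTop, c / 2 ≤ (n : ℝ) * criticalTwoPoint 3 (Pi.single 0 (n : ℤ)) := by
    have h1 : ∀ᶠ n : ℕ in atTop, c / 2 < criticalTwoPoint 3 (Pi.single 0 (n : ℤ)) * (n : ℝ) ^ (2 * Δ) :=
      hseq.eventually (lt_mem_nhds (by linarith))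
    have h2 : ∀ᶠ n : ℕ in atTop, 1 ≤ n := eventually_ge_atTop 1
    filter_upwards [h1, h2] with n hn hn1
    have hnpos : (0 : ℝ) < n := by exact_mod_cast hn1
    have hone : (1 : ℝ) ≤ (n : ℝ) ^ (1 - 2 * Δ) :=
      Real.one_le_rpow (by exact_mod_cast hn1) (by linarith)
    have hsplit : (n : ℝ) * criticalTwoPoint 3 (Pi.single 0 (n : ℤ)) =
        (criticalTwoPoint 3 (Pi.single 0 (n : ℤ)) * (n : ℝ) ^ (2 * Δ)) * (n : ℝ) ^ (1 - 2 * Δ) := by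
      rw [mul_assoc, ← Real.rpow_add hnpos, show 2 * Δ + (1 - 2 * Δ) = (1 : ℝ) by ring, Real.rpow_one,
        mul_comm]
    rw [hsplit]
    calc c / 2 = c / 2 * 1 := (mul_one _).symm
      _ ≤ (criticalTwoPoint 3 (Pi.single 0 (n : ℤ)) * (n : ℝ) ^ (2 * Δ)) * (n : ℝ) ^ (1 - 2 * Δ) :=
          mul_le_mul hn.le hone zero_le_one (by linarith)
  obtain ⟨n, hn1, hn2⟩ := ((hNS (c / 2) (by linarith)).and_eventually hev).exists
  linarith
/-! ## §4 Numerics (kit compute; adversarial tests of clause (ii) at `n = 4`)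

Job `j006843` (queued 2026-08-15T23:1xZ, farm saturated at submit time; 8 cores × 6 h, `--workitem
stmt-CriticalPhenomena-4801`, bundle `mcjob/main.py` in this seat's folder; pilot `j006820`): Swendsen–Wang at
`β_c = 0.221654626` on `128³` periodic, translation- and `O_h`-averaged four-point functions for the
rounding-free lattice instance of `E_{2,2}` proposed by card `two-shell-exchange-markov` ("Fastest refutation"):
`⟨σ_{ae₁}σ_{ae₂}σ_{be₁}σ_{−be₁}⟩` against `⟨σ_{be₁}σ_{be₂}σ_{ae₁}σ_{−ae₁}⟩`, `(a,b) ∈ {(4,12),(6,18)}`, with the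
`O_h`-trivial control pair (`{ae₁,ae₂,be₁,be₃}` vs `{be₁,be₂,ae₁,ae₃}`, equal configuration by configuration)
and the Wick parts from the measured two-point functions (they agree identically between the two sides, so the
test reads the connected part `U₄`). Conformal covariance of the limit (clause (ii) of `Q`) predicts ratio `→ 1`
up to corrections `O(a^{-ω}) + O((b/L)^{·})`; a converged ratio `≠ 1` would be evidence toward `¬Q` (hence toward
`¬crux` AND `¬Ising3DConformalLimit`). RESULTS: pending at this write (see the next revision of this file / the
`compute-j006843.json` evidence on the item).

## §5 Why the crux resists, and what a prover must supply

* Logical position: `¬crux ↔ P ∧ ¬Q` (§1). `P` (item 0634) is open and consistent with every tree fact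
  (`Δ ∈ [1/2,1]` is all the tree pins); `Q` (item 1344) is the conjunct minus (iii). No junk handle: `S` is
  existential (take `S := 0` off `NonCoincident`), `ρ` is pinned by `P` anyway (§1), coincident lattice
  roundings are excluded by local uniformity on the open non-coincident set, `n = 0, 1, 3` clauses are
  consistent (`⟨1⟩ = 1`; odd correlators vanish in the symmetric critical state, `m*(β_c(3)) = 0` —
  `MagnetizationContinuity.lean`, `CriticalGibbsUniqueness.lean`).
* Dropping `0 < c` collapses the crux to 1344 (§1); dropping isotropy (sup-norm law) or going model-blind kills
  it (§2 and cycle-1 §1''): any proof USES `0 < c`, the Euclidean norm in `P`, and Ising-specific structure of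
  `criticalCorr 3` at `n ≥ 4`.
* Irreducible content = existence of the `n ≥ 4` pointwise limits along the full filter `δ → 0⁺` + their `O(3)`
  invariance + inversion covariance. The round-1 lines locate it in: K1/K2 of `two-shell-exchange-markov`
  (exchangeability of sphere traces + trace-Markov inheritance), items 5352–5357 of `PrimaryAtInfinity`
  (first multipole at infinity + `η > 0` via NonSaturation), D1/D2/LKS of `annulus-kelvin-…` (finite-annulus
  Kelvin symmetry + 1D Gibbs uniqueness along the scale axis). §3 confirms their PROVABLE-NOW stubs (A1–A3, B1)
  and flags the exact load-bearing hypothesis of the group lemma P2 (translations; §3b) and the silence of the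
  exchange hierarchy at generic `n ≥ 6` configurations (§3c).
* Printed status: existence and conformal covariance of the 3D limits are open (Duminil-Copin ICM 2022 §8.4);
  Euclid + scale ⇏ Möbius for bare families (`ScaleCovarianceNotMoebius`), no planar engine (`LiouvilleRigidity`),
  two-point law ⇏ Möbius model-blindly (`TwoPointLawNotMoebius`).
* Strengthenings, status after cycle 2: (S1) model-blind upgrade WITH reflection positivity of the full family —
  REFUTED by computation at weights 3 and 4 (§2b: scalar descendants of (generalized) free fields; Gaussian
  candidates are automatically Möbius once `S₂` is a pure power, the first non-Gaussian RP candidates already fail);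
  (S1′) the same WITH the window `Δ ≤ 1` (or `Δ < 5/2`: no scalar non-primaries in a unitary 3D CFT) — OPEN, no
  counterexample known, this is "scale ⇒ conformal for RP scalar families of low dimension in d = 3"; (S2) WITH the
  DLR/Markov structure of a nearest-neighbour Gibbs field for the OBSERVED field — open (a functional of a Markov field
  is not enough, §2b weight-3 witness; cf. card two-shell K2); (S3) existence-only (`P ⇒` some subsequential
  non-degenerate limit) — true by compactness for subsequences, open along the full filter.
* Kernel-checked bottom line (§1d/§1e, `Negative/EvenReduction.lean` p71588, `…/EvenReductionSharp.lean` p71830,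
  `…/TranslationFree.lean` p72519; `crux_iff_even_sharper` above): to prove the crux one must, for the two-point exponent `Δ` and every EVEN `n ≥ 4`,
  (a) construct the locally uniform limit `T_n` of the `δ^{-nΔ}`-renormalised correlators along the full filter
  `δ → 0⁺` off the diagonals, (b) show `T_n` is `O(3)` invariant, (c) show `T_n` is covariant under the unit
  inversion with weight `Δ`. Translation invariance (lattice-commensurate meshes `δ_m = |a|/(m+1)` along each axis)
  and scale covariance (exact mesh identity `[cx/δ] = [x/(δ/c)]`) of `T_n` are AUTOMATIC, kernel-checked; so is the
  completion by `1`, `c‖·‖^{-2Δ}`, `0` in the other arities. Paper remark (not kernel-checked): invariance under the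
  hyperoctahedral group `O_h` is automatic as well (reflected roundings are lattice translates of rounded reflections
  for all meshes outside a countable set, after a free translation moving every coordinate off the mirror planes), so
  (b) reduces to invariance under rotations about one coordinate axis (`O_h` and the `e₃`-rotations generate `O(3)`).
-/

end Summit.CriticalPhenomena.Ising3DConformalLimit.Cruxes.MoebiusLimitOfTwoPointLaw.Disproof

end
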